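import Literature.MathematicalPhysics.QuantumFieldTheory.Balaban1983to89.B1Eq324DisplayedInteractionLeaf
import Literature.MathematicalPhysics.QuantumFieldTheory.Balaban1983to89.B1Eq324SmallFieldLeafModels

/-!
# `Balaban1983to89.B1Eq324DisplayedInteractionLeafModels` — T. Bałaban, *(Higgs)₂,₃ quantum fields in a finite volume. I. A lower bound*,
Commun. Math. Phys. **85** (1982) 603–626 [Balaban1982Higgs1], (3.24) p. 616 / (3.59) p. 623 with (3.56)–(3.58) p. 622 and Prop. 2.3 (2.33)
p. 611: **LEAF (b) OF THE CUMULANT EXPANSION FOR THE DISPLAYED INTERACTION `V^{(k)}` OF (3.57) ON THE MODEL CLASSES OF RECORD, WITH NO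
COVARIANCE HYPOTHESIS AND NO `⟨χ⟩ ≥ ½` HYPOTHESIS** — the typer's `B1Eq324DisplayedInteractionLeaf.leafB_displayed` (gen 33) with its two
displayed covariance-diagonal bounds `hσA` / `hσφ` fed BY NAME from p29's `B1Eq324SmallFieldLeafModels` (zero background field on the whole
torus — print's *"case Ω = T_ε"* — for both Gaussian factors of (3.56); a (2.23)-regular background on `T_ε` for the scalar factor) and its
small-field input `hZ : ⟨χ(A′)χ(φ′)⟩ ≥ ½` fed from r14's Gaussian tails at the (3.43)/(3.50) threshold; and, with p29's leaf (a) and p27's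
knitting `eq324_chi`, **(3.59) IN ITS PRINTED SHAPE (`B1Sect3Statements.Eq324`) FOR THE (3.56) INTEGRAL OF THE DISPLAYED `V^{(k)}` ON THE MODEL
INSTANCE OF RECORD, EVERY INPUT DISCHARGED EXCEPT LEAF (c)** (the lemma of [2] p. 152, NOT HELD); theorems only, no definition, no `Prop`-valued fact.

statement-level skeleton of published theorems with citation tags; proofs where landed; nothing here is a claim about the Yang–Mills mass gap

PDF held: `paper:balaban1982-cmp85-higgs23-i` (journal page = PDF page + 602); pp. 611, 616, 622–623 [PDF 9, 14, 20–21]; the quotations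
below are those checked by gen 33 against the renders `…-p014-x2.png`, `…-p020-x2.png`, `…-p021-x2.png` (v1.1 docfix p393194) and by p29/r14 in
`B1Eq324SmallFieldLeafModels` / `B1Eq324SmallFieldLeaf` (pp. 610–611).

CITATION HEADER (lean-in-tree rule).  lit-balaban typed skeleton (HOME `run/shared/lean/pub/lit-balaban/`), unit `lit-balaban-typer` gen 34
(`literature-prover-lit-balaban-typer-g34-0`; TAKING #1 line HOME/STATUS.md 2026-08-25T07:39:22Z, free-target protocol G.5-34 (d), window honoured).
SKELETON rows **B1.Eq3.24** / **B1.Eq3.59** (rows of record r12, fold owner / PROXY r14; both `typed`, *"DISCHARGED MODULO NAMED LEAVES"*)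
— CELLS ONLY, no head change.  USED BY NAME, NOTHING RESTATED OR EDITED: the typer's `B1Eq324DisplayedInteractionLeaf.{leafB_displayed,
leafB_displayed_tails, leafB_displayed_printed}` and `B1Eq357FluctuationPolynomial.{law356, rv357, Idx, coefOf, slots, legRV, legParam, chi356,
hasSubgaussianMGF_legRV, half_le_integral_chi356}`; p29's `B1Eq324SmallFieldLeafModels.{bondVar_le_zeroField, siteVar_le_zeroField,
siteVar_le_regular_torus}`; r14's `B1Eq324SmallFieldLeaf.{bondVar, siteVar, one_sub_integral_chiFluctA_le, one_sub_integral_chiFluctφ_le,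
exp_neg_pFn_sq_le_pow, thrF_sq_div, abs_log_integral_chiFluctφ_thrF, integral_chiFluctφ_pos, abs_log_mul_le}`, `B1Eq324GaussianMomentLeaf.{polyMomentBound, one_le_polyMomentBound}`,
`B1Eq324WeightedCumulantLeaf.{leafBConst, leafBConst_nonneg}`, `B1Eq356FluctuationIntegral.integral356C`; p29's
`B1Eq324SmallFieldLeafModels.{abs_log_integral_chiFluctA_thrF_zeroField, integral_chiFluctA_thrF_pos_zeroField}` (leaf (a) for the vector factor, hypothesis-free); p27's
`B1Eq324CumulantTaylor.eq324_chi`; r01/r12's `B1Sect3Statements.Eq324`; gen 33's `B1Eq357FluctuationPolynomial.{integral356C_V357_eq, V357,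
measurable_rv357, abs_rv357_le_of_chi356_ne_zero, integral_chi356, isProbabilityMeasure_law356}`; p15's `B2Prop31ZeroFieldConcrete.gamma0` with r14's
`B1Ineq233LowerZeroFieldTorus.lowConst_pos`, r14's `B1Ineq233LowerBackgroundTorus.ineq233_lower_regular_torus_levelZero` and `B1Eq324SmallFieldLeaf.siteVar_le_of_ineq233_lower'` (§5), r14 g13's `B1Ineq233LowerBackgroundTorus.ineq233_lower_bgVec_torus` and p23/r15's `B1Eq31Concrete.bgVec` (§6); the typer's `B1Eq31Concrete.thrF`; p14's `B1Ineq353Proof.pFn_nonneg`; p36's `B10Eq24Cumulant.{nmoment,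
truncExp, chiMeasure}`; `Literature.Probability.LatticeModels.cumulantOf`.

THE SOURCE TEXT (verbatim).  p. 623 [PDF 21]: *"Using the lemma we get (3.56) = ⟨χ(A′)χ(φ′)exp(V^{(k)})⟩ = exp[Σ_{n=1}^{n̄} (1/n!)⟨(V^{(k)})ⁿ⟩^T
+ O(1)(L^kε)^κ|T₁^{(k)}|], κ > d. (3.59)"*; p. 616 [PDF 14]: *"⟨χ exp(V)⟩ = exp[⟨V⟩ + (1/2!)⟨V²⟩^T + … + (1/n̄!)⟨V^{n̄}⟩^T + O(ε^κ)|T₁|],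
κ > d. (3.24)"*, `⟨·⟩` *"the expectation value with respect to the measure dμ_{C⁽⁰⁾}(A′)dμ_{C⁽⁰⁾(B⁽¹⁾)}(φ′)"*; p. 617: *"The fields A′_j … are
independent Gaussian random variables with the covariances C^{(j),L^jε}"*; p. 611 Prop. 2.3: *"If a configuration A is regular on Ω in the sense
defined in Proposition 2.1, then there exist positive constants δ₀, c₀, γ₀, γ₁ dependent on d and a, and independent of Λ, k, Ω and A, such that
γ₀I ≦ aL^{−2}P(A) + Δ^{(k)} ≦ γ₁I, (2.33)"*; pp. 609–610: *"… paper we will use the case Ω = T_ε only"*.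

WHAT IS PROVED (kernel-checked, 0 `sorry`, standard axioms; theorems only; `μ₀², m² > 0`, `a > 0`, `L > 1` throughout).
§1 THE SCALE-FREE PARAMETER.  `legParam_scaleFree`: `legParam P k (σ₁²·(L^kε)^{−(d−2)}) = σ₁²` — for a covariance-diagonal bound in the
  units of Prop. 2.3 / (1.22) (`σ² = σ₁²(L^kε)^{−(d−2)}`, the shape the tree's (2.33) files deliver) the unit-lattice legs `(L^kε)^{(d−2)/2}A′_b`,
  `(L^kε)^{(d−2)/2}φ′(y)_i` of (3.57) are sub-Gaussian with the ONE parameter `σ₁²`, INDEPENDENT of `k` and `ε`; helpers `tail_thrF_le_pow`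
  (the Gaussian tail total in the tree's `ε`-units, general dimension `d` and component count `n`) and `thrF_pFn_nonneg`.
§2 THE CARRIER-LEVEL CORE (any region data `Ω`, any background `B`; `k < K`, `L^kε ≤ 1`, `N ≥ 1`): the VECTOR factor is hypothesis-free (its
  covariance never sees a background: p29's `bondVar_le_zeroField`, `σ_A² = L²/min{a,8γ₀(μ₀²)}`), the SCALAR factor enters through ONE displayed
  Prop. 2.3-type bound `siteVar y i ≤ σ_φ²(L^kε)^{−(d−2)}`.  **`leafB_displayed_thrF_of_siteVar`**: at the (3.43)/(3.50) threshold
  `t = (L^kε)^{−(d−2)/2}p₁(L^kε)` (`thrF`, `p₁ = B2.pFn b₁ p₁`), under the scale-free smallness `e^{−p₁(L^kε)²/(2dσ_A²)}, e^{−p₁(L^kε)²/(2Nσ_φ²)} ≤ (L^kε)^K`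
  and the tail totals `2d|T^{(k)}|(L^kε)^K, 2N|T^{(k)}|(L^kε)^K ≤ ¼`, gen 33's `leafB_displayed` holds with `hσA`, `hσφ` AND `hZ` discharged:
  `|Σ_{n=1}^{n̄} (κₙ − ⟨(V^{(k)})ⁿ⟩ᵀ_χ)/n!| ≤ leafBConst n̄ M · √(2d|T^{(k)}|(L^kε)^K + 2N|T^{(k)}|(L^kε)^K)`, `M = polyMomentBound univ coefOf qmax n̄ (σ_A² ⊔ σ_φ²)`.
  **`eq359_displayed_of_leafC`**: (3.59) IN ITS PRINTED SHAPE — r01/r12's `B1Sect3Statements.Eq324 lhs cum n̄ C s κ vol` (`lhs = exp[Σ_{n=1}^{n̄} cum n/n! + r]`,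
  `|r| ≤ C s^κ vol`) — HOLDS for `lhs` = r14's (3.56) integral `integral356C C Ω B μ₀² m² a k t (V357 k qmax coef)` of the displayed `V^{(k)}`, `cum` =
  PRINT'S cumulants `κₙ(⟨(V^{(k)})^·⟩)` (`cumulantOf (nmoment rv357 law356)`), `s = L^kε`, `κ = K`, `vol = |T^{(k)}|`, `C = 4(d+N) + leafBConst n̄ M·√(2(d+N)) + C₃`,
  given the smallness conditions at the exponent `2K`, (3.58) on the kernels, the scalar bound `σ_φ²`, and LEAF (c) `hc : |f_χ⁽ⁿ̄⁺¹⁾| ≤ C₃(n̄+1)!(L^kε)^K|T^{(k)}|`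
  on `[0,1]` (the lemma of [2] p. 152) — leaf (a) by p29's `abs_log_integral_chiFluctA_thrF_zeroField` (vector) and r14's `abs_log_integral_chiFluctφ_thrF`
  (scalar) with `abs_log_mul_le`, leaf (b) by the core, knitting by p27's `eq324_chi`, left side by gen 33's `integral356C_V357_eq`; helper `sqrt_tail_le`.
§3 ZERO BACKGROUND, `Ω = T_ε` (both factors of (3.56) — the model instance of record of rows B1.Eq3.24 / B1.Eq3.59; every level `k < K` with `L^kε ≤ 1`,
  every charge data, every volume): `var_le_zeroField` (p29's two zero-field covariance bounds under one roof `σ₁²(L^kε)^{−(d−2)}`,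
  `σ₁² = σ_A² ⊔ σ_φ²`, `σ_φ² = L²/min{a,8γ₀(m²)}`), `hasSubgaussianMGF_legRV_zeroField` (every slot variable of the displayed `V^{(k)}` sub-Gaussian with
  the parameter `σ₁²` — NO hypothesis), **`leafB_displayed_zeroField`** (gen 33's `leafB_displayed` with `hσA`/`hσφ` DISCHARGED; inputs left: (3.58), `t ≥ 0`,
  `⟨χ⟩ ≥ ½`), **`leafB_displayed_zeroField_thrF`** (the core with `σ_φ²` fed by p29's `siteVar_le_zeroField`: `hZ` discharged too),
  `leafB_displayed_zeroField_thrF_printed` ((3.58) in the PRINTED currency — Steiner tree length), **`leafB_displayed_zeroField_printed`** (the `∃ s₁`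
  form: for `d ≥ 1`, `L > 1`, `a, μ₀², m² > 0`, `N ≥ 1`, `b₁ > 0`, `p₁ > ½` and every `K` there is `s₁ > 0` — a function of these numbers only — such
  that for EVERY torus of the family with parameters `(d, L)`, every charge data, every level `k < K_P` with `L^kε ≤ s₁` and both tail totals `≤ ¼`,
  every `qmax`, every kernel family obeying (3.58) and every `n̄`, leaf (b) holds in that shape), and **`eq359_displayed_zeroField_of_leafC`** ((3.59) in
  its printed `Eq324` shape for the (3.56) integral of the displayed `V^{(k)}` on the model instance, EVERY input discharged except leaf (c)).
§4 THE SCALAR FACTOR AT A (2.23)-REGULAR BACKGROUND `A` ON `T_ε` (vector factor as in §2): `sigmaA_pos`, **`leafB_displayed_regular_printed`**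
  (`∃ E₀ > 0, ∃ σ₁² > 0, ∃ s₁ > 0` depending on `(d, L, a, μ₀², m², c, N, b₁, p₁, K)` only: for every charge data with `e² ≤ E₀`, every torus `(d, L)`,
  every level `1 ≦ k = j+1 < K_P` with at least two `(k+1)`-sites per direction and `L^kε ≤ s₁`, every `A` `δ`-regular on `T_ε` with `L^kδ ≦ c|e|`,
  both tail totals `≤ ¼`: leaf (b) for the displayed `V^{(k)}` under `dμ_{C^{(k)}}(A′)dμ_{C^{(k)}(T_ε,A)}(φ′)` with `M = polyMomentBound univ coefOf qmax
  n̄ (σ_A² ⊔ σ₁²)`) and **`eq359_displayed_regular_of_leafC`** (the printed `Eq324` shape on this class modulo leaf (c)), from p29's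
  `siteVar_le_regular_torus` BY NAME.
§5 (v1.1, APPEND-ONLY; §1–§4 and every v1 declaration byte-identical to v1 = p395883 ✓ cdd2724df647) THE (3.24) INSTANCE: the first step `k = 0`
  with ITS OWN measure `dμ_{C⁽⁰⁾}(A′)dμ_{C⁽⁰⁾(B⁽¹⁾)}(φ′)` (p. 616), the background `B^{(1)}` regular on `T_ε`: `siteVar_le_levelZero_regular` (the scalar
  diagonal bound `σ_φ² = (3 min{a,4}/(4L²))⁻¹` from r14's level-`0` (2.33)ₗ `B1Ineq233LowerBackgroundTorus.ineq233_lower_regular_torus_levelZero` BY NAME)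
  and **`eq324_displayed_levelZero_regular_of_leafC`** (r01/r12's `Eq324` for `integral356C C T_ε B^{(1)} … 0 t (V357 0 qmax coef)`, `s = ε`, `κ = K`,
  `vol = |T_ε|`, modulo leaf (c) only) — row B1.Eq3.24's own instance (owner r12; zero head weight).
§6 (v1.2, APPEND-ONLY; every v1.1 declaration byte-identical to p396604 ✓ 9ceb30c8bb0b) THE `k`-TH STEP'S OWN MEASURE: levels `1 ≦ k < K` at the
  background `A^{(k),ε}` of (3.29) (`B1Eq31Concrete.bgVec μ₀² a k A`, `A` a block field on `T^{(k)}` with `|A(x)| ≦ r`, `r·L^kε ≦ c_A`) on the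
  sub-family `M·L′_μ = L^m`: `siteVar_le_bgVec_torus` (`∃ σ₁² > 0, c_A > 0`: the scalar diagonal bound from r14 g13's (2.33)ₗ at the (3.29)
  background `B1Ineq233LowerBackgroundTorus.ineq233_lower_bgVec_torus` BY NAME) and **`eq359_displayed_bgVec_of_leafC`** (the printed `Eq324` shape for
  `integral356C C T_ε A^{(k),ε} μ₀² m² a k t (V357 k qmax coef)` modulo leaf (c) only).
HONEST SCOPE.  (i) Zero head weight: rows B1.Eq3.24/3.59 keep `typed` — leaf (c) (the lemma of [2] p. 152, NOT HELD, acq-09340/07983) is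
untouched, and (3.57)/(3.58) stay DISPLAYED hypotheses (Prop. 3.2 = III Prop. 1).  (ii) Per lattice: `M ∝ (1 ⊔ Σ_i|coefOf i|)^{n̄}` and
`Σ_i|coefOf i| ≤ O(1)(L^kε)^{κ₀}|T^{(k)}|·polyConst` (`B1Eq357FluctuationPolynomial.sum_abs_coefOf_le`), so the constant grows with the volume —
print's volume-uniform `O(1)` in (3.24)/(3.59) lives in connectedness = leaf (c) (typer N-typer-g33-1, r14 DESIGN-B1-324-leafb-chain.md addendum
2026-08-25T03:09Z).  (iii) Classes covered = those where the tree HAS the (2.33) lower half on the whole torus (p29's HONEST SCOPE (ii)) — paper I uses *"the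
case Ω = T_ε only"* (pp. 609–610), which is the setting of (3.56)/(3.59); p29's region classes `Ω = B^k(Λ_k)` (his §5/§6) belong to paper II's
conditional measures and do not live on the (3.56) carrier `law356` (conditioning set `T^{(k)}`); general (large-field) `A` is not covered, as in print.  (iv) Constants `σ₁²`, `4`, `¼` ours, immaterial; print's `κ > d` is here `K` arbitrary.  (v) `k < K` strictly (the
(2.33) files' range).  NOT summit progress; NOT Clay.
-/

open scoped BigOperators NNReal Nat
open _root_.MeasureTheory _root_.ProbabilityTheory

namespace Literature.MathematicalPhysics.QuantumFieldTheory.Balaban1983to89.B1Eq324DisplayedInteractionLeafModels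

open HiggsLattice (ChargeData)
open HiggsFluctMeasure (fluctMeasure)
open HiggsCondGauss228 (condGauss fieldOfCrd)
open B1Eq343FluctuationChi (chiFluctA chiFluctφ)
open B1Ineq358TreeDecaySum (diam)
open B3Ineq213 (treeLen)
open B1Prop32InteractionBound (Leg)
open B1Eq31Concrete (thrF)
open B2Prop31ZeroFieldConcrete (gamma0)
open B1Ineq233LowerZeroFieldTorus (lowConst_pos)
open B1Eq324SmallFieldLeaf (bondVar siteVar one_sub_integral_chiFluctA_le one_sub_integral_chiFluctφ_le exp_neg_pFn_sq_le_pow thrF_sq_div)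
open B1Eq324SmallFieldLeafModels (bondVar_le_zeroField siteVar_le_zeroField siteVar_le_regular_torus)
open Literature.Probability.LatticeModels (cumulantOf)
open B10Eq24Cumulant (nmoment truncExp chiMeasure)
open B1Eq324WeightedCumulantLeaf (leafBConst leafBConst_nonneg)
open B1Eq324GaussianMomentLeaf (polyMomentBound one_le_polyMomentBound)
open B1Eq357FluctuationPolynomial
open B1Eq324DisplayedInteractionLeaf (leafB_displayed leafB_displayed_tails leafB_displayed_printed)

noncomputable section

/-! ## §1 The scale-free sub-Gaussian parameter -/

section ScaleFree

variable {P : HiggsLattice.Params}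

/-- **THE SCALE-FREE PARAMETER**: `legParam P k (σ₁²·(L^kε)^{−(d−2)}) = σ₁²` (`σ₁² ≥ 0`) — with a covariance-diagonal bound in the units of
(1.22)/(2.33) the unit-lattice legs `(L^kε)^{(d−2)/2}A′_b`, `(L^kε)^{(d−2)/2}φ′(y)_i` of (3.57) are sub-Gaussian with a parameter independent of
`k` and `ε`. [cite: Balaban1982Higgs1, (1.22) p.607; Prop. 2.3 (2.33) p.611; (3.57) p.622] -/
theorem legParam_scaleFree (k : ℕ) {σ1sq : ℝ} (hσ : 0 ≤ σ1sq) :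
    legParam P k (σ1sq * P.mesh k ^ (-((P.d : ℝ) - 2))) = σ1sq.toNNReal := by
  have hm : 0 < P.mesh k := P.mesh_pos k
  have hpow : (P.mesh k ^ (((P.d : ℝ) - 2) / 2)) ^ 2 = P.mesh k ^ ((P.d : ℝ) - 2) := by
    rw [← Real.rpow_natCast, ← Real.rpow_mul hm.le]
    congr 1
    push_cast
    ring
  have hprod : P.mesh k ^ ((P.d : ℝ) - 2) * P.mesh k ^ (-((P.d : ℝ) - 2)) = 1 := by
    rw [Real.rpow_neg hm.le, mul_inv_cancel₀ (Real.rpow_pos_of_pos hm _).ne']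
  have hσ' : 0 ≤ σ1sq * P.mesh k ^ (-((P.d : ℝ) - 2)) := mul_nonneg hσ (Real.rpow_nonneg hm.le _)
  apply NNReal.eq
  simp only [legParam, NNReal.coe_mul, Real.coe_toNNReal _ hσ', Real.coe_toNNReal _ hσ]
  calc (P.mesh k ^ (((P.d : ℝ) - 2) / 2)) ^ 2 * (σ1sq * P.mesh k ^ (-((P.d : ℝ) - 2)))
      = σ1sq * (P.mesh k ^ ((P.d : ℝ) - 2) * P.mesh k ^ (-((P.d : ℝ) - 2))) := by rw [hpow]; ring
    _ = σ1sq := by rw [hprod, mul_one]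

/-- The tail total in the tree's `ε`-units for `n` components in dimension `d`: with `t = thrF d s p` and `σ² = σ₁²s^{−(d−2)}` the Gaussian
exponent is `p²/(2nσ₁²)` (r14's `thrF_sq_div`), so `e^{−p²/(2nσ₁²)} ≤ s^K` bounds `2n·vol·e^{−t²/(2nσ²)}` by `2n·vol·s^K`.
[cite: Balaban1982Higgs1, (1.22) p.607; (3.43) p.619] -/
theorem tail_thrF_le_pow {d n : ℕ} {s σ1sq p vol : ℝ} (hs : 0 < s) (hvol : 0 ≤ vol) {K : ℕ}
    (hexp : Real.exp (-(p ^ 2 / (2 * n * σ1sq))) ≤ s ^ K) :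
    2 * n * vol * Real.exp (-(thrF d s p ^ 2 / (2 * n * (σ1sq * s ^ (-((d : ℝ) - 2)))))) ≤ 2 * n * vol * s ^ K := by
  rw [thrF_sq_div d n hs p σ1sq]
  exact mul_le_mul_of_nonneg_left hexp (by positivity)

/-- The (3.43)/(3.50) threshold `(L^kε)^{−(d−2)/2}p₁(L^kε)` is `≥ 0` (`b₁ ≥ 0`, `0 < L^kε ≤ 1`). [cite: Balaban1982Higgs1, (3.43) p.619; (3.50) p.621] -/
theorem thrF_pFn_nonneg (k : ℕ) {b₁ : ℝ} (hb : 0 ≤ b₁) (p₁ : ℝ) (hs : P.mesh k ≤ 1) :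
    0 ≤ thrF P.d (P.mesh k) (B2.pFn b₁ p₁ (P.mesh k)) := by
  unfold thrF
  exact mul_nonneg (Real.rpow_nonneg (P.mesh_pos k).le _) (B1Ineq353Proof.pFn_nonneg hb (P.mesh_pos k) hs)

end ScaleFree

/-! ## §2 The carrier-level core: the vector factor hypothesis-free, the scalar factor modulo ONE (2.33)-type diagonal bound -/

section Core

variable {P : HiggsLattice.Params} {N : ℕ}
  (C : ChargeData N) (Ω : Finset (HiggsLattice.Site P 0)) (B : HiggsLattice.VecField P 0)

open B1Eq356FluctuationIntegral (integral356C)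
open B1Eq324CumulantTaylor (eq324_chi)
open B1Eq324SmallFieldLeaf (abs_log_mul_le abs_log_integral_chiFluctφ_thrF integral_chiFluctφ_pos)
open B1Eq324SmallFieldLeafModels (abs_log_integral_chiFluctA_thrF_zeroField integral_chiFluctA_thrF_pos_zeroField)

/-- **LEAF (b) FOR THE DISPLAYED `V^{(k)}` ON THE (3.56) CARRIER AT THE (3.43)/(3.50) THRESHOLD, THE VECTOR FACTOR HYPOTHESIS-FREE AND THE
SCALAR FACTOR MODULO ONE PROP. 2.3-TYPE DIAGONAL BOUND**: under `dμ_{C^{(k)}}(A′)dμ_{C^{(k)}(Ω,B)}(φ′)` (`law356 C Ω B`, ANY region data `Ω`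
and background `B`; `μ₀², m² > 0`, `a > 0`, `L > 1`, `k < K`, `L^kε ≤ 1`, `N ≥ 1`), with `σ_A² = L²/min{a,8γ₀(μ₀²)}` (the vector covariance never
sees a background: p29's `bondVar_le_zeroField`), a displayed scalar bound `siteVar y i ≤ σ_φ²(L^kε)^{−(d−2)}` (`σ_φ² > 0`; what Prop. 2.3 (2.33)
delivers, cf. r14's `siteVar_le_of_ineq233_lower'`), the threshold `t = (L^kε)^{−(d−2)/2}p₁(L^kε)` (`b₁ > 0`), the scale-free smallness
`e^{−p₁(L^kε)²/(2dσ_A²)}, e^{−p₁(L^kε)²/(2Nσ_φ²)} ≤ (L^kε)^K` and the tail totals `2d|T^{(k)}|(L^kε)^K, 2N|T^{(k)}|(L^kε)^K ≤ ¼`, kernels obeying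
(3.58) (diameter currency): `|Σ_{n=1}^{n̄} (κₙ(⟨(V^{(k)})^·⟩) − ⟨(V^{(k)})ⁿ⟩ᵀ_χ)/n!| ≤ leafBConst n̄ M · √(2d|T^{(k)}|(L^kε)^K + 2N|T^{(k)}|(L^kε)^K)`,
`M = polyMomentBound univ coefOf qmax n̄ (σ_A² ⊔ σ_φ²)` — gen 33's `leafB_displayed_tails` with `hσA` discharged, `hσφ` in (2.33)-units, `hZ`
discharged from r14's tails. [cite: Balaban1982Higgs1, (3.24) p.616; (3.59) p.623; (3.43) p.619; (3.50) p.621; Prop. 3.2 (3.57)–(3.58) p.622; (2.33) p.611] -/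
theorem leafB_displayed_thrF_of_siteVar {μ0sq msq a : ℝ} (hμ : 0 < μ0sq) (hmsq : 0 < msq) (ha : 0 < a) (hL : 1 < P.L)
    {k : ℕ} (hk : k < P.K) (hs : P.mesh k ≤ 1) (hN : 0 < N) {σφ1sq : ℝ} (hσφ0 : 0 < σφ1sq)
    (hσφ : ∀ (y : HiggsLattice.Site P k) (i : Fin N),
      siteVar P C Ω B msq a k Finset.univ y i ≤ σφ1sq * P.mesh k ^ (-((P.d : ℝ) - 2)))
    {b₁ p₁ : ℝ} (hb : 0 < b₁) {K : ℕ}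
    (hexpA : Real.exp (-(B2.pFn b₁ p₁ (P.mesh k) ^ 2
        / (2 * P.d * (min a (8 * gamma0 P a μ0sq) / (P.L : ℝ) ^ 2)⁻¹))) ≤ P.mesh k ^ K)
    (hexpφ : Real.exp (-(B2.pFn b₁ p₁ (P.mesh k) ^ 2 / (2 * N * σφ1sq))) ≤ P.mesh k ^ K)
    (hsmallA : 2 * P.d * Fintype.card (HiggsLattice.Site P k) * P.mesh k ^ K ≤ 1 / 4)
    (hsmallφ : 2 * N * Fintype.card (HiggsLattice.Site P k) * P.mesh k ^ K ≤ 1 / 4)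
    (qmax : ℕ) (coef : (q : ℕ) → (Fin q → HiggsLattice.Site P k) → (Fin q → Leg N P.d) → ℝ)
    {A₀ δ₀ : ℝ} (hA₀ : 0 ≤ A₀) (hδ₀ : 0 < δ₀)
    (h358 : ∀ q, q ≤ qmax → ∀ (z : Fin q → HiggsLattice.Site P k) (κ : Fin q → Leg N P.d),
      |coef q z κ| ≤ A₀ * Real.exp (-(δ₀ * (diam z : ℝ))))
    (nbar : ℕ) :
    |∑ n ∈ Finset.Icc 1 nbar,
        (cumulantOf (nmoment (rv357 k qmax coef) (law356 C Ω B μ0sq msq a k)) n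
          - truncExp (rv357 k qmax coef)
              (chiMeasure (law356 C Ω B μ0sq msq a k) (chi356 k (thrF P.d (P.mesh k) (B2.pFn b₁ p₁ (P.mesh k))))) n) / (n ! : ℝ)|
      ≤ leafBConst nbar (polyMomentBound Finset.univ (coefOf k qmax coef) qmax nbar
            (max ((min a (8 * gamma0 P a μ0sq) / (P.L : ℝ) ^ 2)⁻¹) σφ1sq).toNNReal)
        * Real.sqrt (2 * P.d * Fintype.card (HiggsLattice.Site P k) * P.mesh k ^ K
            + 2 * N * Fintype.card (HiggsLattice.Site P k) * P.mesh k ^ K) := by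
  have hLr : (1 : ℝ) < (P.L : ℝ) := by exact_mod_cast hL
  have hm : 0 < P.mesh k := P.mesh_pos k
  have hmr : 0 ≤ P.mesh k ^ (-((P.d : ℝ) - 2)) := Real.rpow_nonneg hm.le _
  have hσA0 : 0 < (min a (8 * gamma0 P a μ0sq) / (P.L : ℝ) ^ 2)⁻¹ := inv_pos.mpr (lowConst_pos ha hL hμ.le)
  have hσ0 : 0 ≤ max ((min a (8 * gamma0 P a μ0sq) / (P.L : ℝ) ^ 2)⁻¹) σφ1sq := le_max_of_le_left hσA0.le
  have ht := thrF_pFn_nonneg (P := P) k hb.le p₁ hs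
  have hvol : (0 : ℝ) ≤ Fintype.card (HiggsLattice.Site P k) := Nat.cast_nonneg _
  -- covariance-diagonal bounds under one roof `σ_A² ⊔ σ_φ²`
  have hbA : ∀ b : HiggsLattice.PBond P k, bondVar P μ0sq a k b
      ≤ max ((min a (8 * gamma0 P a μ0sq) / (P.L : ℝ) ^ 2)⁻¹) σφ1sq * P.mesh k ^ (-((P.d : ℝ) - 2)) := fun b =>
    (bondVar_le_zeroField hμ ha hL hk hs b).trans (mul_le_mul_of_nonneg_right (le_max_left _ _) hmr)
  have hbφ : ∀ (y : HiggsLattice.Site P k) (i : Fin N), siteVar P C Ω B msq a k Finset.univ y i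
      ≤ max ((min a (8 * gamma0 P a μ0sq) / (P.L : ℝ) ^ 2)⁻¹) σφ1sq * P.mesh k ^ (-((P.d : ℝ) - 2)) := fun y i =>
    (hσφ y i).trans (mul_le_mul_of_nonneg_right (le_max_right _ _) hmr)
  -- the two one-factor tails at the threshold, in the tree's ε-units
  have hτA : 1 - ∫ A', chiFluctA (thrF P.d (P.mesh k) (B2.pFn b₁ p₁ (P.mesh k))) A' ∂(fluctMeasure P μ0sq a k)
      ≤ 2 * P.d * Fintype.card (HiggsLattice.Site P k) * P.mesh k ^ K :=
    (one_sub_integral_chiFluctA_le (P := P) hμ ha hLr hk.le (mul_pos hσA0 (Real.rpow_pos_of_pos hm _))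
      (bondVar_le_zeroField hμ ha hL hk hs) ht).trans (tail_thrF_le_pow hm hvol hexpA)
  have hτφ : 1 - ∫ x, chiFluctφ (thrF P.d (P.mesh k) (B2.pFn b₁ p₁ (P.mesh k)))
        (fieldOfCrd (Finset.univ : Finset (HiggsLattice.Site P k)) x)
        ∂(condGauss C Ω B msq a k (Finset.univ : Finset (HiggsLattice.Site P k)))
      ≤ 2 * N * Fintype.card (HiggsLattice.Site P k) * P.mesh k ^ K :=
    (one_sub_integral_chiFluctφ_le C Ω B hmsq ha hLr hk.le Finset.univ hN (mul_pos hσφ0 (Real.rpow_pos_of_pos hm _))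
      hσφ ht).trans (tail_thrF_le_pow hm hvol hexpφ)
  have hZ : 1 / 2 ≤ ∫ ω, chi356 (P := P) (N := N) k (thrF P.d (P.mesh k) (B2.pFn b₁ p₁ (P.mesh k))) ω
      ∂(law356 C Ω B μ0sq msq a k) :=
    half_le_integral_chi356 C Ω B hμ hmsq ha hLr hk.le _ (hτA.trans hsmallA) (hτφ.trans hsmallφ)
  have h := leafB_displayed_tails C Ω B hμ hmsq ha hLr hk.le hbA hbφ qmax coef hA₀ hδ₀ ht h358 hZ nbar
  rw [legParam_scaleFree k hσ0] at h
  exact h.trans (mul_le_mul_of_nonneg_left (Real.sqrt_le_sqrt (add_le_add hτA hτφ))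
    (leafBConst_nonneg nbar (zero_le_one.trans (one_le_polyMomentBound _ _ _ _ _))))

/-- `√(c·vol·(s^K)²) ≤ √c·vol·s^K` for a site count `vol ∈ ℕ` (`√vol ≤ vol`) — the leaf-(b) square root in the `C·s^κ·vol` currency of
(3.24)/(3.59). [cite: Balaban1982Higgs1, (3.24) p.616] -/
theorem sqrt_tail_le {c s : ℝ} (hc : 0 ≤ c) (hs : 0 ≤ s) (vol K : ℕ) :
    Real.sqrt (c * vol * (s ^ K) ^ 2) ≤ Real.sqrt c * vol * s ^ K := by
  have hv : (0 : ℝ) ≤ vol := Nat.cast_nonneg vol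
  have hv2 : (vol : ℝ) ≤ (vol : ℝ) ^ 2 := by exact_mod_cast Nat.le_self_pow two_ne_zero vol
  have hsK : 0 ≤ s ^ K := pow_nonneg hs K
  rw [Real.sqrt_mul (mul_nonneg hc hv), Real.sqrt_sq hsK, Real.sqrt_mul hc]
  refine mul_le_mul_of_nonneg_right (mul_le_mul_of_nonneg_left ?_ (Real.sqrt_nonneg c)) hsK
  calc Real.sqrt vol ≤ Real.sqrt ((vol : ℝ) ^ 2) := Real.sqrt_le_sqrt hv2
    _ = vol := Real.sqrt_sq hv

/-- **(3.59) — IN THE PRINTED SHAPE `⟨χ(A′)χ(φ′)exp(V^{(k)})⟩ = exp[Σ_{n=1}^{n̄}(1/n!)⟨(V^{(k)})ⁿ⟩^T + O(1)(L^kε)^κ|T^{(k)}|]` (r01/r12's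
`B1Sect3Statements.Eq324`) — FOR r14's (3.56) INTEGRAL OF THE DISPLAYED `V^{(k)}` OF (3.57) ON THE CARRIER, EVERY INPUT DISCHARGED EXCEPT ONE
PROP. 2.3-TYPE SCALAR DIAGONAL BOUND AND LEAF (c)**: under `law356 C Ω B` (any `Ω`, `B`; `μ₀², m² > 0`, `a > 0`, `L > 1`, `k < K`, `L^kε ≤ 1`,
`N ≥ 1`), with `siteVar y i ≤ σ_φ²(L^kε)^{−(d−2)}` (`σ_φ² > 0`), the (3.43)/(3.50) threshold `t = (L^kε)^{−(d−2)/2}p₁(L^kε)` (`b₁ > 0`), the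
scale-free smallness `e^{−p₁(L^kε)²/(2dσ_A²)}, e^{−p₁(L^kε)²/(2Nσ_φ²)} ≤ (L^kε)^{2K}` and tail totals `2d|T^{(k)}|(L^kε)^{2K}, 2N|T^{(k)}|(L^kε)^{2K} ≤ ¼`,
kernels obeying (3.58) (diameter currency), and LEAF (c) as the displayed hypothesis `hc` (`|f_χ⁽ⁿ̄⁺¹⁾(t)| ≤ C₃(n̄+1)!(L^kε)^K|T^{(k)}|` on
`[0,1]`, `f_χ(t) = log⟨χ e^{tV}⟩` — the lemma of [2] p. 152, NOT HELD):
`Eq324 ((3.56) for V^{(k)}) (κ_·(⟨(V^{(k)})^·⟩)) n̄ (4(d+N) + leafBConst n̄ M·√(2(d+N)) + C₃) (L^kε) K |T^{(k)}|`, `M = polyMomentBound univ coefOf qmax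
n̄ (σ_A² ⊔ σ_φ²)` — leaf (a) by p29's `abs_log_integral_chiFluctA_thrF_zeroField` (vector) and r14's `abs_log_integral_chiFluctφ_thrF` (scalar) with
r14's `abs_log_mul_le`, leaf (b) by `leafB_displayed_thrF_of_siteVar`, knitting by p27's `eq324_chi`, left side by gen 33's `integral356C_V357_eq`.
Per lattice (HONEST SCOPE (ii)); zero head weight. [cite: Balaban1982Higgs1, (3.59) p.623; (3.24) p.616; (3.56)–(3.58) p.622; (2.33) p.611] -/
theorem eq359_displayed_of_leafC {μ0sq msq a : ℝ} (hμ : 0 < μ0sq) (hmsq : 0 < msq) (ha : 0 < a) (hL : 1 < P.L)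
    {k : ℕ} (hk : k < P.K) (hs : P.mesh k ≤ 1) (hN : 0 < N) {σφ1sq : ℝ} (hσφ0 : 0 < σφ1sq)
    (hσφ : ∀ (y : HiggsLattice.Site P k) (i : Fin N),
      siteVar P C Ω B msq a k Finset.univ y i ≤ σφ1sq * P.mesh k ^ (-((P.d : ℝ) - 2)))
    {b₁ p₁ : ℝ} (hb : 0 < b₁) {K : ℕ}
    (hexpA : Real.exp (-(B2.pFn b₁ p₁ (P.mesh k) ^ 2
        / (2 * P.d * (min a (8 * gamma0 P a μ0sq) / (P.L : ℝ) ^ 2)⁻¹))) ≤ P.mesh k ^ (2 * K))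
    (hexpφ : Real.exp (-(B2.pFn b₁ p₁ (P.mesh k) ^ 2 / (2 * N * σφ1sq))) ≤ P.mesh k ^ (2 * K))
    (hsmallA : 2 * P.d * Fintype.card (HiggsLattice.Site P k) * P.mesh k ^ (2 * K) ≤ 1 / 4)
    (hsmallφ : 2 * N * Fintype.card (HiggsLattice.Site P k) * P.mesh k ^ (2 * K) ≤ 1 / 4)
    (qmax : ℕ) (coef : (q : ℕ) → (Fin q → HiggsLattice.Site P k) → (Fin q → Leg N P.d) → ℝ)
    {A₀ δ₀ : ℝ} (hA₀ : 0 ≤ A₀) (hδ₀ : 0 < δ₀)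
    (h358 : ∀ q, q ≤ qmax → ∀ (z : Fin q → HiggsLattice.Site P k) (κ : Fin q → Leg N P.d),
      |coef q z κ| ≤ A₀ * Real.exp (-(δ₀ * (diam z : ℝ))))
    (nbar : ℕ) {C₃ : ℝ}
    (hc : ∀ t ∈ Set.Icc (0 : ℝ) 1,
      |iteratedDeriv (nbar + 1) (cgf (rv357 k qmax coef)
          (chiMeasure (law356 C Ω B μ0sq msq a k) (chi356 k (thrF P.d (P.mesh k) (B2.pFn b₁ p₁ (P.mesh k)))))) t|
        ≤ C₃ * ((nbar + 1)! : ℝ) * P.mesh k ^ K * Fintype.card (HiggsLattice.Site P k)) :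
    B1Sect3Statements.Eq324
      (integral356C C Ω B μ0sq msq a k (thrF P.d (P.mesh k) (B2.pFn b₁ p₁ (P.mesh k))) (V357 k qmax coef))
      (cumulantOf (nmoment (rv357 k qmax coef) (law356 C Ω B μ0sq msq a k))) nbar
      (4 * (P.d + N)
        + leafBConst nbar (polyMomentBound Finset.univ (coefOf k qmax coef) qmax nbar
            (max ((min a (8 * gamma0 P a μ0sq) / (P.L : ℝ) ^ 2)⁻¹) σφ1sq).toNNReal) * Real.sqrt (2 * (P.d + N))
        + C₃)
      (P.mesh k) K (Fintype.card (HiggsLattice.Site P k)) := by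
  have hLr : (1 : ℝ) < (P.L : ℝ) := by exact_mod_cast hL
  haveI := isProbabilityMeasure_law356 C Ω B hμ hmsq ha hLr hk.le
  have hm : 0 < P.mesh k := P.mesh_pos k
  have ht := thrF_pFn_nonneg (P := P) k hb.le p₁ hs
  have hvol : (0 : ℝ) ≤ Fintype.card (HiggsLattice.Site P k) := Nat.cast_nonneg _
  have hdN : (0 : ℝ) ≤ 2 * (P.d + N) := by positivity
  -- `(L^kε)^{2K} ≤ (L^kε)^K`
  have hpow : P.mesh k ^ (2 * K) ≤ P.mesh k ^ K := pow_le_pow_of_le_one hm.le hs (by omega)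
  have hKr : P.mesh k ^ (K : ℝ) = P.mesh k ^ K := Real.rpow_natCast _ _
  -- leaf (a): the vector factor on the model (p29), the scalar factor modulo `σ_φ²` (r14), at the exponent `2K`, weakened to `K`
  have hsmallA' : 2 * P.d * Fintype.card (HiggsLattice.Site P k) * P.mesh k ^ (2 * K) ≤ 1 / 2 := hsmallA.trans (by norm_num)
  have hsmallφ' : 2 * N * Fintype.card (HiggsLattice.Site P k) * P.mesh k ^ (2 * K) ≤ 1 / 2 := hsmallφ.trans (by norm_num)
  have haA := abs_log_integral_chiFluctA_thrF_zeroField (P := P) hμ ha hL hk hs hb hexpA hsmallA'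
  have hposA := integral_chiFluctA_thrF_pos_zeroField (P := P) hμ ha hL hk hs hb hexpA hsmallA'
  have haφ := abs_log_integral_chiFluctφ_thrF C Ω B hmsq ha hLr hk.le Finset.univ hN hσφ0 hσφ hb hs hexpφ hsmallφ'
  have hτφexp : 2 * N * Fintype.card (HiggsLattice.Site P k)
        * Real.exp (-(thrF P.d (P.mesh k) (B2.pFn b₁ p₁ (P.mesh k)) ^ 2
            / (2 * N * (σφ1sq * P.mesh k ^ (-((P.d : ℝ) - 2)))))) ≤ 1 / 2 :=
    (tail_thrF_le_pow hm hvol hexpφ).trans hsmallφ'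
  have hposφ := integral_chiFluctφ_pos C Ω B hmsq ha hLr hk.le Finset.univ hN (mul_pos hσφ0 (Real.rpow_pos_of_pos hm _)) hσφ ht hτφexp
  have hpos' : 0 < ∫ ω, chi356 (P := P) (N := N) k (thrF P.d (P.mesh k) (B2.pFn b₁ p₁ (P.mesh k))) ω ∂(law356 C Ω B μ0sq msq a k) := by
    rw [integral_chi356 C Ω B hμ hmsq ha hLr hk.le]
    exact mul_pos hposA hposφ
  have haK : |Real.log (∫ ω, chi356 (P := P) (N := N) k (thrF P.d (P.mesh k) (B2.pFn b₁ p₁ (P.mesh k))) ω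
        ∂(law356 C Ω B μ0sq msq a k))|
      ≤ 4 * (P.d + N) * P.mesh k ^ (K : ℝ) * Fintype.card (HiggsLattice.Site P k) := by
    rw [hKr, integral_chi356 C Ω B hμ hmsq ha hLr hk.le]
    refine (abs_log_mul_le hposA hposφ).trans ((add_le_add haA haφ).trans ?_)
    have h1 : 4 * P.d * Fintype.card (HiggsLattice.Site P k) * P.mesh k ^ (2 * K)
        ≤ 4 * P.d * Fintype.card (HiggsLattice.Site P k) * P.mesh k ^ K := mul_le_mul_of_nonneg_left hpow (by positivity)
    have h2 : 4 * N * Fintype.card (HiggsLattice.Site P k) * P.mesh k ^ (2 * K)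
        ≤ 4 * N * Fintype.card (HiggsLattice.Site P k) * P.mesh k ^ K := mul_le_mul_of_nonneg_left hpow (by positivity)
    nlinarith
  -- leaf (b) (§2 core), at the exponent `2K`, in the `C·s^κ·vol` currency
  have hb' := leafB_displayed_thrF_of_siteVar C Ω B hμ hmsq ha hL hk hs hN hσφ0 hσφ hb hexpA hexpφ hsmallA hsmallφ
    qmax coef hA₀ hδ₀ h358 nbar
  have hbK : |∑ n ∈ Finset.Icc 1 nbar,
        (cumulantOf (nmoment (rv357 k qmax coef) (law356 C Ω B μ0sq msq a k)) n
          - truncExp (rv357 k qmax coef)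
              (chiMeasure (law356 C Ω B μ0sq msq a k) (chi356 k (thrF P.d (P.mesh k) (B2.pFn b₁ p₁ (P.mesh k))))) n) / (n ! : ℝ)|
      ≤ leafBConst nbar (polyMomentBound Finset.univ (coefOf k qmax coef) qmax nbar
            (max ((min a (8 * gamma0 P a μ0sq) / (P.L : ℝ) ^ 2)⁻¹) σφ1sq).toNNReal)
          * Real.sqrt (2 * (P.d + N)) * P.mesh k ^ (K : ℝ) * Fintype.card (HiggsLattice.Site P k) := by
    rw [hKr]
    refine hb'.trans ?_
    have hM0 : 0 ≤ leafBConst nbar (polyMomentBound Finset.univ (coefOf k qmax coef) qmax nbar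
        (max ((min a (8 * gamma0 P a μ0sq) / (P.L : ℝ) ^ 2)⁻¹) σφ1sq).toNNReal) :=
      leafBConst_nonneg nbar (zero_le_one.trans (one_le_polyMomentBound _ _ _ _ _))
    have heq : 2 * (P.d : ℝ) * Fintype.card (HiggsLattice.Site P k) * P.mesh k ^ (2 * K)
          + 2 * N * Fintype.card (HiggsLattice.Site P k) * P.mesh k ^ (2 * K)
        = 2 * (P.d + N) * Fintype.card (HiggsLattice.Site P k) * (P.mesh k ^ K) ^ 2 := by ring
    rw [heq]
    have hsq := sqrt_tail_le hdN hm.le (Fintype.card (HiggsLattice.Site P k)) K (s := P.mesh k)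
    calc leafBConst nbar _ * Real.sqrt (2 * (P.d + N) * Fintype.card (HiggsLattice.Site P k) * (P.mesh k ^ K) ^ 2)
        ≤ leafBConst nbar _ * (Real.sqrt (2 * (P.d + N)) * Fintype.card (HiggsLattice.Site P k) * P.mesh k ^ K) :=
          mul_le_mul_of_nonneg_left hsq hM0
      _ = _ := by ring
  -- leaf (c) in the real-exponent currency
  have hcK : ∀ t ∈ Set.Icc (0 : ℝ) 1,
      |iteratedDeriv (nbar + 1) (cgf (rv357 k qmax coef)
          (chiMeasure (law356 C Ω B μ0sq msq a k) (chi356 k (thrF P.d (P.mesh k) (B2.pFn b₁ p₁ (P.mesh k)))))) t|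
        ≤ C₃ * ((nbar + 1)! : ℝ) * P.mesh k ^ (K : ℝ) * Fintype.card (HiggsLattice.Site P k) := by
    rw [hKr]; exact hc
  rw [integral356C_V357_eq C Ω B hμ hmsq ha hLr hk.le qmax coef hA₀ hδ₀ ht h358]
  exact eq324_chi (measurable_chi356 k _) (chi356_nonneg k _) (chi356_le_one k _) hpos'
    (measurable_rv357 (P := P) (N := N) k qmax coef).aemeasurable
    (abs_rv357_le_of_chi356_ne_zero k qmax coef hA₀ hδ₀ ht h358) nbar _ haK hbK hcK

end Core

/-! ## §3 Zero background, `Ω = T_ε`: both factors of (3.56) (the model instance of record of rows B1.Eq3.24 / B1.Eq3.59) -/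

section ZeroField

variable {P : HiggsLattice.Params} {N : ℕ} (C : ChargeData N)

/-- The two zero-field covariance bounds of p29 under ONE roof: with `σ₁² = L²/min{a,8γ₀(μ₀²)} ⊔ L²/min{a,8γ₀(m²)}` every `bondVar b` and every
`siteVar y i` (scalar factor at zero background, `Ω = T_ε`, conditioning set `T^{(k)}`) is `≤ σ₁²(L^kε)^{−(d−2)}` (`k < K`, `L^kε ≤ 1`).
[cite: Balaban1982Higgs1, Prop. 2.3 (2.33) p.611] -/
theorem var_le_zeroField {μ0sq msq a : ℝ} (hμ : 0 < μ0sq) (hmsq : 0 < msq) (ha : 0 < a) (hL : 1 < P.L) {k : ℕ} (hk : k < P.K)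
    (hs : P.mesh k ≤ 1) :
    (∀ b : HiggsLattice.PBond P k, bondVar P μ0sq a k b
        ≤ max ((min a (8 * gamma0 P a μ0sq) / (P.L : ℝ) ^ 2)⁻¹) ((min a (8 * gamma0 P a msq) / (P.L : ℝ) ^ 2)⁻¹)
          * P.mesh k ^ (-((P.d : ℝ) - 2)))
    ∧ ∀ (y : HiggsLattice.Site P k) (i : Fin N),
        siteVar P C Finset.univ (0 : HiggsLattice.VecField P 0) msq a k Finset.univ y i
          ≤ max ((min a (8 * gamma0 P a μ0sq) / (P.L : ℝ) ^ 2)⁻¹) ((min a (8 * gamma0 P a msq) / (P.L : ℝ) ^ 2)⁻¹)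
            * P.mesh k ^ (-((P.d : ℝ) - 2)) := by
  have hm : 0 ≤ P.mesh k ^ (-((P.d : ℝ) - 2)) := Real.rpow_nonneg (P.mesh_pos k).le _
  exact ⟨fun b => (bondVar_le_zeroField hμ ha hL hk hs b).trans (mul_le_mul_of_nonneg_right (le_max_left _ _) hm),
    fun y i => (siteVar_le_zeroField C hmsq ha hL hk hs Finset.univ y i).trans (mul_le_mul_of_nonneg_right (le_max_right _ _) hm)⟩

/-- **EVERY SLOT VARIABLE OF THE DISPLAYED `V^{(k)}` IS SUB-GAUSSIAN UNDER THE ZERO-BACKGROUND PRODUCT LAW WITH A SCALE-FREE PARAMETER, NO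
HYPOTHESIS**: under `dμ_{C^{(k)}}(A′) dμ_{C^{(k)}(T_ε,0)}(φ′)` (`law356 C T_ε 0`) each `legRV i s`, `s ∈ slots i`, has Mathlib's `HasSubgaussianMGF` with
parameter `σ₁² = L²/min{a,8γ₀(μ₀²)} ⊔ L²/min{a,8γ₀(m²)}` (`μ₀², m² > 0`, `a > 0`, `L > 1`, `k < K`, `L^kε ≤ 1`; every charge data, every volume) —
p. 617 *"independent Gaussian random variables with the covariances C^{(j),L^jε}"* with the covariances bounded by the tree's (2.33) at zero field.
[cite: Balaban1982Higgs1, (3.24) p.616; p.617; Prop. 2.3 (2.33) p.611] -/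
theorem hasSubgaussianMGF_legRV_zeroField {μ0sq msq a : ℝ} (hμ : 0 < μ0sq) (hmsq : 0 < msq) (ha : 0 < a) (hL : 1 < P.L)
    {k : ℕ} (hk : k < P.K) (hs : P.mesh k ≤ 1) (qmax : ℕ) :
    ∀ i ∈ (Finset.univ : Finset (Idx P N k qmax)), ∀ s ∈ slots k qmax i,
      HasSubgaussianMGF (legRV k qmax i s)
        (max ((min a (8 * gamma0 P a μ0sq) / (P.L : ℝ) ^ 2)⁻¹) ((min a (8 * gamma0 P a msq) / (P.L : ℝ) ^ 2)⁻¹)).toNNReal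
        (law356 C Finset.univ (0 : HiggsLattice.VecField P 0) μ0sq msq a k) := by
  have hLr : (1 : ℝ) < (P.L : ℝ) := by exact_mod_cast hL
  have hσ0 : 0 ≤ max ((min a (8 * gamma0 P a μ0sq) / (P.L : ℝ) ^ 2)⁻¹) ((min a (8 * gamma0 P a msq) / (P.L : ℝ) ^ 2)⁻¹) :=
    le_max_of_le_left (inv_pos.mpr (lowConst_pos ha hL hμ.le)).le
  obtain ⟨hσA, hσφ⟩ := var_le_zeroField C hμ hmsq ha hL hk hs
  rw [← legParam_scaleFree k hσ0]
  exact hasSubgaussianMGF_legRV C Finset.univ 0 hμ hmsq ha hLr hk.le hσA hσφ qmax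

/-- **LEAF (b) FOR THE DISPLAYED `V^{(k)}` AT ZERO BACKGROUND, NO COVARIANCE HYPOTHESIS**: under `law356 C T_ε 0` (`μ₀², m² > 0`, `a > 0`,
`L > 1`, `k < K`, `L^kε ≤ 1`), with the kernels obeying (3.58) (diameter currency, `A₀ ≥ 0`, `δ₀ > 0`), a cut-off threshold `t ≥ 0` and
`⟨χ(A′)χ(φ′)⟩ ≥ ½`: `|Σ_{n=1}^{n̄} (κₙ(⟨(V^{(k)})^·⟩) − ⟨(V^{(k)})ⁿ⟩ᵀ_χ)/n!| ≤ leafBConst n̄ M · √(∫(1 − χ(A′)χ(φ′)))`,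
`M = polyMomentBound univ coefOf qmax n̄ σ₁²`, `σ₁² = L²/min{a,8γ₀(μ₀²)} ⊔ L²/min{a,8γ₀(m²)}` — gen 33's `leafB_displayed` with `hσA`, `hσφ`
DISCHARGED by p29's `bondVar_le_zeroField` / `siteVar_le_zeroField`. [cite: Balaban1982Higgs1, (3.24) p.616; (3.59) p.623; Prop. 3.2 (3.57)–(3.58) p.622; (2.33) p.611] -/
theorem leafB_displayed_zeroField {μ0sq msq a : ℝ} (hμ : 0 < μ0sq) (hmsq : 0 < msq) (ha : 0 < a) (hL : 1 < P.L)
    {k : ℕ} (hk : k < P.K) (hs : P.mesh k ≤ 1)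
    (qmax : ℕ) (coef : (q : ℕ) → (Fin q → HiggsLattice.Site P k) → (Fin q → Leg N P.d) → ℝ)
    {A₀ δ₀ t : ℝ} (hA₀ : 0 ≤ A₀) (hδ₀ : 0 < δ₀) (ht : 0 ≤ t)
    (h358 : ∀ q, q ≤ qmax → ∀ (z : Fin q → HiggsLattice.Site P k) (κ : Fin q → Leg N P.d),
      |coef q z κ| ≤ A₀ * Real.exp (-(δ₀ * (diam z : ℝ))))
    (hZ : 1 / 2 ≤ ∫ ω, chi356 (P := P) (N := N) k t ω ∂(law356 C Finset.univ (0 : HiggsLattice.VecField P 0) μ0sq msq a k))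
    (nbar : ℕ) :
    |∑ n ∈ Finset.Icc 1 nbar,
        (cumulantOf (nmoment (rv357 k qmax coef) (law356 C Finset.univ (0 : HiggsLattice.VecField P 0) μ0sq msq a k)) n
          - truncExp (rv357 k qmax coef)
              (chiMeasure (law356 C Finset.univ (0 : HiggsLattice.VecField P 0) μ0sq msq a k) (chi356 k t)) n) / (n ! : ℝ)|
      ≤ leafBConst nbar (polyMomentBound Finset.univ (coefOf k qmax coef) qmax nbar
            (max ((min a (8 * gamma0 P a μ0sq) / (P.L : ℝ) ^ 2)⁻¹) ((min a (8 * gamma0 P a msq) / (P.L : ℝ) ^ 2)⁻¹)).toNNReal)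
        * Real.sqrt (∫ ω, (1 - chi356 (P := P) (N := N) k t ω)
            ∂(law356 C Finset.univ (0 : HiggsLattice.VecField P 0) μ0sq msq a k)) := by
  have hLr : (1 : ℝ) < (P.L : ℝ) := by exact_mod_cast hL
  have hσ0 : 0 ≤ max ((min a (8 * gamma0 P a μ0sq) / (P.L : ℝ) ^ 2)⁻¹) ((min a (8 * gamma0 P a msq) / (P.L : ℝ) ^ 2)⁻¹) :=
    le_max_of_le_left (inv_pos.mpr (lowConst_pos ha hL hμ.le)).le
  obtain ⟨hσA, hσφ⟩ := var_le_zeroField C hμ hmsq ha hL hk hs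
  have h := leafB_displayed C Finset.univ 0 hμ hmsq ha hLr hk.le hσA hσφ qmax coef hA₀ hδ₀ ht h358 hZ nbar
  rwa [legParam_scaleFree k hσ0] at h

/-- **LEAF (b) FOR THE DISPLAYED `V^{(k)}` AT ZERO BACKGROUND AT THE (3.43)/(3.50) THRESHOLD — `hσ` AND `hZ` BOTH DISCHARGED**: with
`t = (L^kε)^{−(d−2)/2}p₁(L^kε)` (`thrF`, `p₁ = B2.pFn b₁ p₁`, `b₁ > 0`), `σ_A² = L²/min{a,8γ₀(μ₀²)}`, `σ_φ² = L²/min{a,8γ₀(m²)}`, the scale-free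
smallness conditions `e^{−p₁(L^kε)²/(2dσ_A²)} ≤ (L^kε)^K`, `e^{−p₁(L^kε)²/(2Nσ_φ²)} ≤ (L^kε)^K` and the tail totals `2d|T^{(k)}|(L^kε)^K ≤ ¼`,
`2N|T^{(k)}|(L^kε)^K ≤ ¼` (`N ≥ 1`): `|Σ_{n=1}^{n̄} (κₙ − ⟨(V^{(k)})ⁿ⟩ᵀ_χ)/n!| ≤ leafBConst n̄ M · √(2d|T^{(k)}|(L^kε)^K + 2N|T^{(k)}|(L^kε)^K)`,
`M = polyMomentBound univ coefOf qmax n̄ (σ_A² ⊔ σ_φ²)` — the tails by r14's `one_sub_integral_chiFluctA_le` / `…φ_le`, `⟨χ⟩ ≥ ½` by the typer's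
`half_le_integral_chi356`. [cite: Balaban1982Higgs1, (3.24) p.616; (3.59) p.623; (3.43) p.619; (3.50) p.621; Prop. 3.2 (3.57)–(3.58) p.622] -/
theorem leafB_displayed_zeroField_thrF {μ0sq msq a : ℝ} (hμ : 0 < μ0sq) (hmsq : 0 < msq) (ha : 0 < a) (hL : 1 < P.L)
    {k : ℕ} (hk : k < P.K) (hs : P.mesh k ≤ 1) (hN : 0 < N) {b₁ p₁ : ℝ} (hb : 0 < b₁) {K : ℕ}
    (hexpA : Real.exp (-(B2.pFn b₁ p₁ (P.mesh k) ^ 2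
        / (2 * P.d * (min a (8 * gamma0 P a μ0sq) / (P.L : ℝ) ^ 2)⁻¹))) ≤ P.mesh k ^ K)
    (hexpφ : Real.exp (-(B2.pFn b₁ p₁ (P.mesh k) ^ 2
        / (2 * N * (min a (8 * gamma0 P a msq) / (P.L : ℝ) ^ 2)⁻¹))) ≤ P.mesh k ^ K)
    (hsmallA : 2 * P.d * Fintype.card (HiggsLattice.Site P k) * P.mesh k ^ K ≤ 1 / 4)
    (hsmallφ : 2 * N * Fintype.card (HiggsLattice.Site P k) * P.mesh k ^ K ≤ 1 / 4)
    (qmax : ℕ) (coef : (q : ℕ) → (Fin q → HiggsLattice.Site P k) → (Fin q → Leg N P.d) → ℝ)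
    {A₀ δ₀ : ℝ} (hA₀ : 0 ≤ A₀) (hδ₀ : 0 < δ₀)
    (h358 : ∀ q, q ≤ qmax → ∀ (z : Fin q → HiggsLattice.Site P k) (κ : Fin q → Leg N P.d),
      |coef q z κ| ≤ A₀ * Real.exp (-(δ₀ * (diam z : ℝ))))
    (nbar : ℕ) :
    |∑ n ∈ Finset.Icc 1 nbar,
        (cumulantOf (nmoment (rv357 k qmax coef) (law356 C Finset.univ (0 : HiggsLattice.VecField P 0) μ0sq msq a k)) n
          - truncExp (rv357 k qmax coef)
              (chiMeasure (law356 C Finset.univ (0 : HiggsLattice.VecField P 0) μ0sq msq a k)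
                (chi356 k (thrF P.d (P.mesh k) (B2.pFn b₁ p₁ (P.mesh k))))) n) / (n ! : ℝ)|
      ≤ leafBConst nbar (polyMomentBound Finset.univ (coefOf k qmax coef) qmax nbar
            (max ((min a (8 * gamma0 P a μ0sq) / (P.L : ℝ) ^ 2)⁻¹) ((min a (8 * gamma0 P a msq) / (P.L : ℝ) ^ 2)⁻¹)).toNNReal)
        * Real.sqrt (2 * P.d * Fintype.card (HiggsLattice.Site P k) * P.mesh k ^ K
            + 2 * N * Fintype.card (HiggsLattice.Site P k) * P.mesh k ^ K) := by
  have hσφ0 : 0 < (min a (8 * gamma0 P a msq) / (P.L : ℝ) ^ 2)⁻¹ := inv_pos.mpr (lowConst_pos ha hL hmsq.le)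
  exact leafB_displayed_thrF_of_siteVar C Finset.univ 0 hμ hmsq ha hL hk hs hN hσφ0 (siteVar_le_zeroField C hmsq ha hL hk hs Finset.univ)
    hb hexpA hexpφ hsmallA hsmallφ qmax coef hA₀ hδ₀ h358 nbar

/-- **THE SAME WITH (3.58) IN THE PRINTED CURRENCY** (decay in the length of the shortest graph connecting the argument points, Steiner vertices
allowed: `B1Eq356DisplayedBounds.coef_bound_diam_of_steiner` via gen 33's `leafB_displayed_printed`). [cite: Balaban1982Higgs1, (3.24) p.616; (3.59) p.623; Prop. 3.2 (3.57)–(3.58) p.622] -/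
theorem leafB_displayed_zeroField_thrF_printed {μ0sq msq a : ℝ} (hμ : 0 < μ0sq) (hmsq : 0 < msq) (ha : 0 < a) (hL : 1 < P.L)
    {k : ℕ} (hk : k < P.K) (hs : P.mesh k ≤ 1) (hN : 0 < N) {b₁ p₁ : ℝ} (hb : 0 < b₁) {K : ℕ}
    (hexpA : Real.exp (-(B2.pFn b₁ p₁ (P.mesh k) ^ 2
        / (2 * P.d * (min a (8 * gamma0 P a μ0sq) / (P.L : ℝ) ^ 2)⁻¹))) ≤ P.mesh k ^ K)
    (hexpφ : Real.exp (-(B2.pFn b₁ p₁ (P.mesh k) ^ 2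
        / (2 * N * (min a (8 * gamma0 P a msq) / (P.L : ℝ) ^ 2)⁻¹))) ≤ P.mesh k ^ K)
    (hsmallA : 2 * P.d * Fintype.card (HiggsLattice.Site P k) * P.mesh k ^ K ≤ 1 / 4)
    (hsmallφ : 2 * N * Fintype.card (HiggsLattice.Site P k) * P.mesh k ^ K ≤ 1 / 4)
    (qmax : ℕ) (coef : (q : ℕ) → (Fin q → HiggsLattice.Site P k) → (Fin q → Leg N P.d) → ℝ)
    {A₀ δ₀ : ℝ} (hA₀ : 0 ≤ A₀) (hδ₀ : 0 < δ₀)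
    (h358 : ∀ q, q ≤ qmax → ∀ (z : Fin q → HiggsLattice.Site P k) (κ : Fin q → Leg N P.d), ∃ (n : ℕ) (w : Fin n → HiggsLattice.Site P k),
      |coef q z κ| ≤ A₀ * Real.exp (-(δ₀ * treeLen (fun a b : Fin q ⊕ Fin n =>
        (HiggsLattice.Site.tdist (Sum.elim z w a) (Sum.elim z w b) : ℝ)))))
    (nbar : ℕ) :
    |∑ n ∈ Finset.Icc 1 nbar,
        (cumulantOf (nmoment (rv357 k qmax coef) (law356 C Finset.univ (0 : HiggsLattice.VecField P 0) μ0sq msq a k)) n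
          - truncExp (rv357 k qmax coef)
              (chiMeasure (law356 C Finset.univ (0 : HiggsLattice.VecField P 0) μ0sq msq a k)
                (chi356 k (thrF P.d (P.mesh k) (B2.pFn b₁ p₁ (P.mesh k))))) n) / (n ! : ℝ)|
      ≤ leafBConst nbar (polyMomentBound Finset.univ (coefOf k qmax coef) qmax nbar
            (max ((min a (8 * gamma0 P a μ0sq) / (P.L : ℝ) ^ 2)⁻¹) ((min a (8 * gamma0 P a msq) / (P.L : ℝ) ^ 2)⁻¹)).toNNReal)
        * Real.sqrt (2 * P.d * Fintype.card (HiggsLattice.Site P k) * P.mesh k ^ K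
            + 2 * N * Fintype.card (HiggsLattice.Site P k) * P.mesh k ^ K) :=
  leafB_displayed_zeroField_thrF C hμ hmsq ha hL hk hs hN hb hexpA hexpφ hsmallA hsmallφ qmax coef hA₀ hδ₀
    (B1Eq356DisplayedBounds.coef_bound_diam_of_steiner hA₀ hδ₀.le h358) nbar

/-- **LEAF (b) FOR THE DISPLAYED `V^{(k)}` ON THE MODEL INSTANCE OF RECORD (zero background, `Ω = T_ε`), PRINTED FORM — NO COVARIANCE AND
NO SMALL-FIELD-PROBABILITY HYPOTHESIS**: for `d ≥ 1`, `L > 1`, `a, μ₀², m² > 0`, `N ≥ 1`, `b₁ > 0`, `p₁ > ½` and every `K` there is `s₁ > 0` —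
a function of these numbers only — such that for EVERY torus of the family with parameters `(d, L)`, every charge data, every level `k < K_P`
with `L^kε ≤ s₁` and both tail totals `2d|T^{(k)}|(L^kε)^K`, `2N|T^{(k)}|(L^kε)^K` at most `¼`, every degree `qmax`, every kernel family obeying
(3.58) (diameter currency) and every `n̄`: `|Σ_{n=1}^{n̄} (κₙ(⟨(V^{(k)})^·⟩) − ⟨(V^{(k)})ⁿ⟩ᵀ_χ)/n!| ≤ leafBConst n̄ M · √(2d|T^{(k)}|(L^kε)^K +
2N|T^{(k)}|(L^kε)^K)` at the (3.43)/(3.50) threshold, `M = polyMomentBound univ coefOf qmax n̄ (σ_A² ⊔ σ_φ²)` — print's leaf-(b) error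
`O((L^kε)^{κ/2})` per lattice with `κ = K` arbitrary. [cite: Balaban1982Higgs1, (3.24) p.616; (3.59) p.623; Prop. 3.2 (3.57)–(3.58) p.622; (2.33) p.611] -/
theorem leafB_displayed_zeroField_printed (d L : ℕ) (hd : 0 < d) (hL : 1 < L) {a μ0sq msq : ℝ} (ha : 0 < a) (hμ : 0 < μ0sq)
    (hmsq : 0 < msq) {N : ℕ} (hN : 0 < N) {b₁ p₁ : ℝ} (hb : 0 < b₁) (hp : 1 / 2 < p₁) (K : ℕ) :
    ∃ s₁ : ℝ, 0 < s₁ ∧ ∀ (P : HiggsLattice.Params), P.d = d → P.L = L → ∀ (C : ChargeData N),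
      ∀ {k : ℕ}, k < P.K → P.mesh k ≤ s₁ →
        2 * P.d * Fintype.card (HiggsLattice.Site P k) * P.mesh k ^ K ≤ 1 / 4 →
        2 * N * Fintype.card (HiggsLattice.Site P k) * P.mesh k ^ K ≤ 1 / 4 →
        ∀ (qmax : ℕ) (coef : (q : ℕ) → (Fin q → HiggsLattice.Site P k) → (Fin q → Leg N P.d) → ℝ) {A₀ δ₀ : ℝ},
          0 ≤ A₀ → 0 < δ₀ →
          (∀ q, q ≤ qmax → ∀ (z : Fin q → HiggsLattice.Site P k) (κ : Fin q → Leg N P.d),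
            |coef q z κ| ≤ A₀ * Real.exp (-(δ₀ * (diam z : ℝ)))) →
          ∀ nbar : ℕ,
            |∑ n ∈ Finset.Icc 1 nbar,
                (cumulantOf (nmoment (rv357 k qmax coef)
                    (law356 C Finset.univ (0 : HiggsLattice.VecField P 0) μ0sq msq a k)) n
                  - truncExp (rv357 k qmax coef)
                      (chiMeasure (law356 C Finset.univ (0 : HiggsLattice.VecField P 0) μ0sq msq a k)
                        (chi356 k (thrF P.d (P.mesh k) (B2.pFn b₁ p₁ (P.mesh k))))) n) / (n ! : ℝ)|
              ≤ leafBConst nbar (polyMomentBound Finset.univ (coefOf k qmax coef) qmax nbar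
                    (max ((min a (8 * gamma0 P a μ0sq) / (P.L : ℝ) ^ 2)⁻¹)
                      ((min a (8 * gamma0 P a msq) / (P.L : ℝ) ^ 2)⁻¹)).toNNReal)
                * Real.sqrt (2 * P.d * Fintype.card (HiggsLattice.Site P k) * P.mesh k ^ K
                    + 2 * N * Fintype.card (HiggsLattice.Site P k) * P.mesh k ^ K) := by
  -- the two scale-free variance constants of the `(d, L)` family, written without `P`
  obtain ⟨σA, hσA⟩ : ∃ σ : ℝ, σ = (min a (8 * (min (a * (1 - (((L : ℕ) : ℝ) ^ 2)⁻¹) / (8 * ((d : ℕ) : ℝ) + 2 * μ0sq)) (1 / 4)))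
      / ((L : ℕ) : ℝ) ^ 2)⁻¹ := ⟨_, rfl⟩
  obtain ⟨σφ, hσφ⟩ : ∃ σ : ℝ, σ = (min a (8 * (min (a * (1 - (((L : ℕ) : ℝ) ^ 2)⁻¹) / (8 * ((d : ℕ) : ℝ) + 2 * msq)) (1 / 4)))
      / ((L : ℕ) : ℝ) ^ 2)⁻¹ := ⟨_, rfl⟩
  have hLr : (1 : ℝ) < ((L : ℕ) : ℝ) := by exact_mod_cast hL
  have h1 : 0 < 1 - (((L : ℕ) : ℝ) ^ 2)⁻¹ := by
    have : (1 : ℝ) < ((L : ℕ) : ℝ) ^ 2 := by nlinarith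
    have : (((L : ℕ) : ℝ) ^ 2)⁻¹ < 1 := inv_lt_one_of_one_lt₀ this
    linarith
  have hd' : (0 : ℝ) ≤ ((d : ℕ) : ℝ) := Nat.cast_nonneg d
  have hγ : ∀ {m : ℝ}, 0 < m → 0 < min (a * (1 - (((L : ℕ) : ℝ) ^ 2)⁻¹) / (8 * ((d : ℕ) : ℝ) + 2 * m)) (1 / 4) := fun hm =>
    lt_min (div_pos (mul_pos ha h1) (by linarith)) (by norm_num)
  have hσApos : 0 < σA := by
    rw [hσA]; exact inv_pos.mpr (div_pos (lt_min ha (by linarith [hγ hμ])) (by positivity))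
  have hσφpos : 0 < σφ := by
    rw [hσφ]; exact inv_pos.mpr (div_pos (lt_min ha (by linarith [hγ hmsq])) (by positivity))
  obtain ⟨sA, hsA, hA⟩ := exp_neg_pFn_sq_le_pow hd hσApos hb hp K
  obtain ⟨sφ, hsφ, hφ⟩ := exp_neg_pFn_sq_le_pow hN hσφpos hb hp K
  refine ⟨min (min sA sφ) 1, lt_min (lt_min hsA hsφ) one_pos, fun P hPd hPL C k hk hs hsmallA hsmallφ qmax coef A₀ δ₀ hA₀ hδ₀ h358 nbar => ?_⟩
  subst hPd hPL
  have hm : 0 < P.mesh k := P.mesh_pos k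
  have hs1 : P.mesh k ≤ 1 := hs.trans (min_le_right _ _)
  have heA := hA (P.mesh k) hm (hs.trans ((min_le_left _ _).trans (min_le_left _ _)))
  have heφ := hφ (P.mesh k) hm (hs.trans ((min_le_left _ _).trans (min_le_right _ _)))
  have hσAP : σA = (min a (8 * gamma0 P a μ0sq) / (P.L : ℝ) ^ 2)⁻¹ := by rw [hσA]; rfl
  have hσφP : σφ = (min a (8 * gamma0 P a msq) / (P.L : ℝ) ^ 2)⁻¹ := by rw [hσφ]; rfl
  rw [hσAP] at heA
  rw [hσφP] at heφ
  exact leafB_displayed_zeroField_thrF C hμ hmsq ha hL hk hs1 hN hb heA heφ hsmallA hsmallφ qmax coef hA₀ hδ₀ h358 nbar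

/-- **(3.59) IN ITS PRINTED SHAPE (`B1Sect3Statements.Eq324`) FOR r14's (3.56) INTEGRAL OF THE DISPLAYED `V^{(k)}` ON THE MODEL INSTANCE OF RECORD
(zero background, `Ω = T_ε`), EVERY INPUT DISCHARGED EXCEPT LEAF (c)** — `eq359_displayed_of_leafC` with the scalar diagonal bound fed by p29's
`siteVar_le_zeroField` (`σ_φ² = L²/min{a,8γ₀(m²)}`): `Eq324 (integral356C C T_ε 0 … t (V357 k qmax coef)) (κ_·(⟨(V^{(k)})^·⟩)) n̄ (4(d+N) +
leafBConst n̄ M·√(2(d+N)) + C₃) (L^kε) K |T^{(k)}|`, `M = polyMomentBound univ coefOf qmax n̄ (σ_A² ⊔ σ_φ²)`, under the §2 smallness conditions at the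
exponent `2K` and LEAF (c) `hc` (the lemma of [2] p. 152, NOT HELD). Per lattice; zero head weight.
[cite: Balaban1982Higgs1, (3.59) p.623; (3.24) p.616; (3.56)–(3.58) p.622; (2.33) p.611] -/
theorem eq359_displayed_zeroField_of_leafC {μ0sq msq a : ℝ} (hμ : 0 < μ0sq) (hmsq : 0 < msq) (ha : 0 < a) (hL : 1 < P.L)
    {k : ℕ} (hk : k < P.K) (hs : P.mesh k ≤ 1) (hN : 0 < N) {b₁ p₁ : ℝ} (hb : 0 < b₁) {K : ℕ}
    (hexpA : Real.exp (-(B2.pFn b₁ p₁ (P.mesh k) ^ 2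
        / (2 * P.d * (min a (8 * gamma0 P a μ0sq) / (P.L : ℝ) ^ 2)⁻¹))) ≤ P.mesh k ^ (2 * K))
    (hexpφ : Real.exp (-(B2.pFn b₁ p₁ (P.mesh k) ^ 2
        / (2 * N * (min a (8 * gamma0 P a msq) / (P.L : ℝ) ^ 2)⁻¹))) ≤ P.mesh k ^ (2 * K))
    (hsmallA : 2 * P.d * Fintype.card (HiggsLattice.Site P k) * P.mesh k ^ (2 * K) ≤ 1 / 4)
    (hsmallφ : 2 * N * Fintype.card (HiggsLattice.Site P k) * P.mesh k ^ (2 * K) ≤ 1 / 4)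
    (qmax : ℕ) (coef : (q : ℕ) → (Fin q → HiggsLattice.Site P k) → (Fin q → Leg N P.d) → ℝ)
    {A₀ δ₀ : ℝ} (hA₀ : 0 ≤ A₀) (hδ₀ : 0 < δ₀)
    (h358 : ∀ q, q ≤ qmax → ∀ (z : Fin q → HiggsLattice.Site P k) (κ : Fin q → Leg N P.d),
      |coef q z κ| ≤ A₀ * Real.exp (-(δ₀ * (diam z : ℝ))))
    (nbar : ℕ) {C₃ : ℝ}
    (hc : ∀ t ∈ Set.Icc (0 : ℝ) 1,
      |iteratedDeriv (nbar + 1) (cgf (rv357 k qmax coef)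
          (chiMeasure (law356 C Finset.univ (0 : HiggsLattice.VecField P 0) μ0sq msq a k)
            (chi356 k (thrF P.d (P.mesh k) (B2.pFn b₁ p₁ (P.mesh k)))))) t|
        ≤ C₃ * ((nbar + 1)! : ℝ) * P.mesh k ^ K * Fintype.card (HiggsLattice.Site P k)) :
    B1Sect3Statements.Eq324
      (B1Eq356FluctuationIntegral.integral356C C Finset.univ (0 : HiggsLattice.VecField P 0) μ0sq msq a k
        (thrF P.d (P.mesh k) (B2.pFn b₁ p₁ (P.mesh k))) (V357 k qmax coef))
      (cumulantOf (nmoment (rv357 k qmax coef) (law356 C Finset.univ (0 : HiggsLattice.VecField P 0) μ0sq msq a k))) nbar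
      (4 * (P.d + N)
        + leafBConst nbar (polyMomentBound Finset.univ (coefOf k qmax coef) qmax nbar
            (max ((min a (8 * gamma0 P a μ0sq) / (P.L : ℝ) ^ 2)⁻¹) ((min a (8 * gamma0 P a msq) / (P.L : ℝ) ^ 2)⁻¹)).toNNReal)
          * Real.sqrt (2 * (P.d + N))
        + C₃)
      (P.mesh k) K (Fintype.card (HiggsLattice.Site P k)) :=
  eq359_displayed_of_leafC C Finset.univ 0 hμ hmsq ha hL hk hs hN (inv_pos.mpr (lowConst_pos ha hL hmsq.le))
    (siteVar_le_zeroField C hmsq ha hL hk hs Finset.univ) hb hexpA hexpφ hsmallA hsmallφ qmax coef hA₀ hδ₀ h358 nbar hc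

end ZeroField

/-! ## §4 The scalar factor at a (2.23)-regular background on `T_ε` -/

section Regular

/-- The vector variance constant `σ_A² = L²/min{a,8γ₀(μ₀²)}` of the `(d, L)` family written without the torus `P` (so that a scale threshold
can be chosen before the torus), `γ₀ = min(a(1 − L⁻²)/(8d + 2μ₀²), ¼)` (p15's `B2Prop31ZeroFieldConcrete.gamma0`): it is positive (`L > 1`, `a, μ₀² > 0`).
[cite: Balaban1982Higgs1, Prop. 2.3 (2.33) p.611] -/
theorem sigmaA_pos (d : ℕ) {L : ℕ} (hL : 1 < L) {a μ0sq : ℝ} (ha : 0 < a) (hμ : 0 < μ0sq) :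
    0 < (min a (8 * (min (a * (1 - (((L : ℕ) : ℝ) ^ 2)⁻¹) / (8 * ((d : ℕ) : ℝ) + 2 * μ0sq)) (1 / 4))) / ((L : ℕ) : ℝ) ^ 2)⁻¹ := by
  have hLr : (1 : ℝ) < ((L : ℕ) : ℝ) := by exact_mod_cast hL
  have h1 : 0 < 1 - (((L : ℕ) : ℝ) ^ 2)⁻¹ := by
    have : (1 : ℝ) < ((L : ℕ) : ℝ) ^ 2 := by nlinarith
    have : (((L : ℕ) : ℝ) ^ 2)⁻¹ < 1 := inv_lt_one_of_one_lt₀ this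
    linarith
  have hd' : (0 : ℝ) ≤ ((d : ℕ) : ℝ) := Nat.cast_nonneg d
  have hγ : 0 < min (a * (1 - (((L : ℕ) : ℝ) ^ 2)⁻¹) / (8 * ((d : ℕ) : ℝ) + 2 * μ0sq)) (1 / 4) :=
    lt_min (div_pos (mul_pos ha h1) (by linarith)) (by norm_num)
  exact inv_pos.mpr (div_pos (lt_min ha (by linarith)) (by positivity))


/-- **LEAF (b) FOR THE DISPLAYED `V^{(k)}` WITH THE SCALAR FACTOR AT A (2.23)-REGULAR BACKGROUND ON THE WHOLE TORUS, PRINTED FORM**: for `d ≥ 1`,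
`L > 1`, `a, μ₀², m² > 0`, a regularity constant `c`, `N ≥ 1`, `b₁ > 0`, `p₁ > ½` and every `K` there are `E₀ > 0`, `σ₁² > 0` and `s₁ > 0`
(functions of these numbers only) such that for every charge data with `e² ≤ E₀`, every torus of the family with parameters `(d, L)`, every level
`1 ≦ k = j+1 < K_P` with at least two `(k+1)`-sites per direction and `L^kε ≤ s₁`, every background `A` `δ`-regular on `T_ε` with `L^kδ ≦ c|e|`,
both tail totals `≤ ¼`, every `qmax`, every kernel family obeying (3.58) and every `n̄`: leaf (b) for the displayed `V^{(k)}` under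
`dμ_{C^{(k)}}(A′) dμ_{C^{(k)}(T_ε,A)}(φ′)` (`law356 C T_ε A`) at the (3.43)/(3.50) threshold, right side `leafBConst n̄ M · √(2d|T^{(k)}|(L^kε)^K +
2N|T^{(k)}|(L^kε)^K)`, `M = polyMomentBound univ coefOf qmax n̄ (σ_A² ⊔ σ₁²)` — the scalar variance from p29's `siteVar_le_regular_torus` (r14's
(2.33)ₗ at regular backgrounds), the vector one as in §2 (its covariance does not see the background). [cite: Balaban1982Higgs1, (3.59) p.623; Prop. 2.3 (2.33) p.611; Prop. 2.1 (2.23) p.610; Prop. 3.2 (3.57)–(3.58) p.622] -/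
theorem leafB_displayed_regular_printed (d L : ℕ) (hd : 0 < d) (hL : 1 < L) {a μ0sq msq : ℝ} (ha : 0 < a) (hμ : 0 < μ0sq)
    (hmsq : 0 < msq) (c : ℝ) {N : ℕ} (hN : 0 < N) {b₁ p₁ : ℝ} (hb : 0 < b₁) (hp : 1 / 2 < p₁) (K : ℕ) :
    ∃ E₀ : ℝ, 0 < E₀ ∧ ∃ σ1sq : ℝ, 0 < σ1sq ∧ ∃ s₁ : ℝ, 0 < s₁ ∧
      ∀ (C : ChargeData N), C.e ^ 2 ≤ E₀ →
      ∀ (P : HiggsLattice.Params), P.d = d → P.L = L →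
      ∀ {j : ℕ}, j + 1 < P.K → (∀ μ, 2 ≤ P.sitesPerDir (j + 1 + 1) μ) → P.mesh (j + 1) ≤ s₁ →
      ∀ (A : HiggsLattice.VecField P 0) {δ : ℝ}, 0 ≤ δ →
        (∀ (z : HiggsLattice.Site P 0) (μ' ν : Fin P.d), |A ⟨z.shift ν, μ'⟩ - A ⟨z, μ'⟩| ≤ δ) →
        (P.L : ℝ) ^ (j + 1) * δ ≤ c * |C.e| →
        2 * P.d * Fintype.card (HiggsLattice.Site P (j + 1)) * P.mesh (j + 1) ^ K ≤ 1 / 4 →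
        2 * N * Fintype.card (HiggsLattice.Site P (j + 1)) * P.mesh (j + 1) ^ K ≤ 1 / 4 →
        ∀ (qmax : ℕ) (coef : (q : ℕ) → (Fin q → HiggsLattice.Site P (j + 1)) → (Fin q → Leg N P.d) → ℝ) {A₀ δ₀ : ℝ},
          0 ≤ A₀ → 0 < δ₀ →
          (∀ q, q ≤ qmax → ∀ (z : Fin q → HiggsLattice.Site P (j + 1)) (κ : Fin q → Leg N P.d),
            |coef q z κ| ≤ A₀ * Real.exp (-(δ₀ * (diam z : ℝ)))) →
          ∀ nbar : ℕ,
            |∑ n ∈ Finset.Icc 1 nbar,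
                (cumulantOf (nmoment (rv357 (j + 1) qmax coef) (law356 C Finset.univ A μ0sq msq a (j + 1))) n
                  - truncExp (rv357 (j + 1) qmax coef)
                      (chiMeasure (law356 C Finset.univ A μ0sq msq a (j + 1))
                        (chi356 (j + 1) (thrF P.d (P.mesh (j + 1)) (B2.pFn b₁ p₁ (P.mesh (j + 1)))))) n) / (n ! : ℝ)|
              ≤ leafBConst nbar (polyMomentBound Finset.univ (coefOf (j + 1) qmax coef) qmax nbar
                    (max ((min a (8 * gamma0 P a μ0sq) / (P.L : ℝ) ^ 2)⁻¹) σ1sq).toNNReal)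
                * Real.sqrt (2 * P.d * Fintype.card (HiggsLattice.Site P (j + 1)) * P.mesh (j + 1) ^ K
                    + 2 * N * Fintype.card (HiggsLattice.Site P (j + 1)) * P.mesh (j + 1) ^ K) := by
  obtain ⟨E₀, hE₀, σ1sq, hσ1, hvar⟩ := siteVar_le_regular_torus d L hL ha hmsq c N
  -- the scale-free vector variance constant of the `(d, L)` family, written without `P`
  obtain ⟨σA, hσA⟩ : ∃ σ : ℝ, σ = (min a (8 * (min (a * (1 - (((L : ℕ) : ℝ) ^ 2)⁻¹) / (8 * ((d : ℕ) : ℝ) + 2 * μ0sq)) (1 / 4)))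
      / ((L : ℕ) : ℝ) ^ 2)⁻¹ := ⟨_, rfl⟩
  have hσApos : 0 < σA := by rw [hσA]; exact sigmaA_pos d hL ha hμ
  obtain ⟨sA, hsA, hA⟩ := exp_neg_pFn_sq_le_pow hd hσApos hb hp K
  obtain ⟨sφ, hsφ, hφ⟩ := exp_neg_pFn_sq_le_pow hN hσ1 hb hp K
  refine ⟨E₀, hE₀, σ1sq, hσ1, min (min sA sφ) 1, lt_min (lt_min hsA hsφ) one_pos,
    fun C heE P hPd hPL j hjK hN2 hs A δ hδ hreg hu hsmallA hsmallφ qmax coef A₀ δ₀ hA₀ hδ₀ h358 nbar => ?_⟩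
  subst hPd hPL
  have hm : 0 < P.mesh (j + 1) := P.mesh_pos _
  have hs1 : P.mesh (j + 1) ≤ 1 := hs.trans (min_le_right _ _)
  have heA := hA (P.mesh (j + 1)) hm (hs.trans ((min_le_left _ _).trans (min_le_left _ _)))
  have heφ := hφ (P.mesh (j + 1)) hm (hs.trans ((min_le_left _ _).trans (min_le_right _ _)))
  have hσAP : σA = (min a (8 * gamma0 P a μ0sq) / (P.L : ℝ) ^ 2)⁻¹ := by rw [hσA]; rfl
  rw [hσAP] at heA
  exact leafB_displayed_thrF_of_siteVar C Finset.univ A hμ hmsq ha hL hjK hs1 hN hσ1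
    (hvar C heE P rfl rfl hjK hN2 hs1 A hδ hreg hu Finset.univ) hb heA heφ hsmallA hsmallφ qmax coef hA₀ hδ₀ h358 nbar

/-- **(3.59) IN ITS PRINTED SHAPE FOR THE DISPLAYED `V^{(k)}` WITH THE SCALAR FACTOR AT A (2.23)-REGULAR BACKGROUND ON `T_ε`, MODULO LEAF (c) ONLY**
(`∃ E₀ > 0, ∃ σ₁² > 0, ∃ s₁ > 0` form, functions of `(d, L, a, μ₀², m², c, N, b₁, p₁, K)` only): for every charge data with `e² ≤ E₀`, every torus
`(d, L)`, every level `1 ≦ k = j+1 < K_P` with at least two `(k+1)`-sites per direction and `L^kε ≤ s₁`, every `A` `δ`-regular on `T_ε` with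
`L^kδ ≦ c|e|`, tail totals `2d|T^{(k)}|(L^kε)^{2K}, 2N|T^{(k)}|(L^kε)^{2K} ≤ ¼`, every `qmax`, kernels obeying (3.58), every `n̄` and LEAF (c) `hc`:
`Eq324 (integral356C C T_ε A … t (V357 k qmax coef)) (κ_·(⟨(V^{(k)})^·⟩)) n̄ (4(d+N) + leafBConst n̄ M·√(2(d+N)) + C₃) (L^kε) K |T^{(k)}|`,
`M = polyMomentBound univ coefOf qmax n̄ (σ_A² ⊔ σ₁²)` — `eq359_displayed_of_leafC` with p29's `siteVar_le_regular_torus`. Per lattice; zero head weight.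
[cite: Balaban1982Higgs1, (3.59) p.623; Prop. 2.3 (2.33) p.611; Prop. 2.1 (2.23) p.610; (3.56)–(3.58) p.622] -/
theorem eq359_displayed_regular_of_leafC (d L : ℕ) (hd : 0 < d) (hL : 1 < L) {a μ0sq msq : ℝ} (ha : 0 < a) (hμ : 0 < μ0sq)
    (hmsq : 0 < msq) (c : ℝ) {N : ℕ} (hN : 0 < N) {b₁ p₁ : ℝ} (hb : 0 < b₁) (hp : 1 / 2 < p₁) (K : ℕ) :
    ∃ E₀ : ℝ, 0 < E₀ ∧ ∃ σ1sq : ℝ, 0 < σ1sq ∧ ∃ s₁ : ℝ, 0 < s₁ ∧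
      ∀ (C : ChargeData N), C.e ^ 2 ≤ E₀ →
      ∀ (P : HiggsLattice.Params), P.d = d → P.L = L →
      ∀ {j : ℕ}, j + 1 < P.K → (∀ μ, 2 ≤ P.sitesPerDir (j + 1 + 1) μ) → P.mesh (j + 1) ≤ s₁ →
      ∀ (A : HiggsLattice.VecField P 0) {δ : ℝ}, 0 ≤ δ →
        (∀ (z : HiggsLattice.Site P 0) (μ' ν : Fin P.d), |A ⟨z.shift ν, μ'⟩ - A ⟨z, μ'⟩| ≤ δ) →
        (P.L : ℝ) ^ (j + 1) * δ ≤ c * |C.e| →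
        2 * P.d * Fintype.card (HiggsLattice.Site P (j + 1)) * P.mesh (j + 1) ^ (2 * K) ≤ 1 / 4 →
        2 * N * Fintype.card (HiggsLattice.Site P (j + 1)) * P.mesh (j + 1) ^ (2 * K) ≤ 1 / 4 →
        ∀ (qmax : ℕ) (coef : (q : ℕ) → (Fin q → HiggsLattice.Site P (j + 1)) → (Fin q → Leg N P.d) → ℝ) {A₀ δ₀ : ℝ},
          0 ≤ A₀ → 0 < δ₀ →
          (∀ q, q ≤ qmax → ∀ (z : Fin q → HiggsLattice.Site P (j + 1)) (κ : Fin q → Leg N P.d),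
            |coef q z κ| ≤ A₀ * Real.exp (-(δ₀ * (diam z : ℝ)))) →
          ∀ (nbar : ℕ) {C₃ : ℝ},
            (∀ t ∈ Set.Icc (0 : ℝ) 1,
              |iteratedDeriv (nbar + 1) (cgf (rv357 (j + 1) qmax coef)
                  (chiMeasure (law356 C Finset.univ A μ0sq msq a (j + 1))
                    (chi356 (j + 1) (thrF P.d (P.mesh (j + 1)) (B2.pFn b₁ p₁ (P.mesh (j + 1))))))) t|
                ≤ C₃ * ((nbar + 1)! : ℝ) * P.mesh (j + 1) ^ K * Fintype.card (HiggsLattice.Site P (j + 1))) →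
            B1Sect3Statements.Eq324
              (B1Eq356FluctuationIntegral.integral356C C Finset.univ A μ0sq msq a (j + 1)
                (thrF P.d (P.mesh (j + 1)) (B2.pFn b₁ p₁ (P.mesh (j + 1)))) (V357 (j + 1) qmax coef))
              (cumulantOf (nmoment (rv357 (j + 1) qmax coef) (law356 C Finset.univ A μ0sq msq a (j + 1)))) nbar
              (4 * (P.d + N)
                + leafBConst nbar (polyMomentBound Finset.univ (coefOf (j + 1) qmax coef) qmax nbar
                    (max ((min a (8 * gamma0 P a μ0sq) / (P.L : ℝ) ^ 2)⁻¹) σ1sq).toNNReal) * Real.sqrt (2 * (P.d + N))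
                + C₃)
              (P.mesh (j + 1)) K (Fintype.card (HiggsLattice.Site P (j + 1))) := by
  obtain ⟨E₀, hE₀, σ1sq, hσ1, hvar⟩ := siteVar_le_regular_torus d L hL ha hmsq c N
  obtain ⟨σA, hσA⟩ : ∃ σ : ℝ, σ = (min a (8 * (min (a * (1 - (((L : ℕ) : ℝ) ^ 2)⁻¹) / (8 * ((d : ℕ) : ℝ) + 2 * μ0sq)) (1 / 4)))
      / ((L : ℕ) : ℝ) ^ 2)⁻¹ := ⟨_, rfl⟩
  have hσApos : 0 < σA := by rw [hσA]; exact sigmaA_pos d hL ha hμ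
  obtain ⟨sA, hsA, hA⟩ := exp_neg_pFn_sq_le_pow hd hσApos hb hp (2 * K)
  obtain ⟨sφ, hsφ, hφ⟩ := exp_neg_pFn_sq_le_pow hN hσ1 hb hp (2 * K)
  refine ⟨E₀, hE₀, σ1sq, hσ1, min (min sA sφ) 1, lt_min (lt_min hsA hsφ) one_pos,
    fun C heE P hPd hPL j hjK hN2 hs A δ hδ hreg hu hsmallA hsmallφ qmax coef A₀ δ₀ hA₀ hδ₀ h358 nbar C₃ hc => ?_⟩
  subst hPd hPL
  have hm : 0 < P.mesh (j + 1) := P.mesh_pos _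
  have hs1 : P.mesh (j + 1) ≤ 1 := hs.trans (min_le_right _ _)
  have heA := hA (P.mesh (j + 1)) hm (hs.trans ((min_le_left _ _).trans (min_le_left _ _)))
  have heφ := hφ (P.mesh (j + 1)) hm (hs.trans ((min_le_left _ _).trans (min_le_right _ _)))
  have hσAP : σA = (min a (8 * gamma0 P a μ0sq) / (P.L : ℝ) ^ 2)⁻¹ := by rw [hσA]; rfl
  rw [hσAP] at heA
  exact eq359_displayed_of_leafC C Finset.univ A hμ hmsq ha hL hjK hs1 hN hσ1
    (hvar C heE P rfl rfl hjK hN2 hs1 A hδ hreg hu Finset.univ) hb heA heφ hsmallA hsmallφ qmax coef hA₀ hδ₀ h358 nbar hc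

end Regular

/-! ## §5 (v1.1) THE (3.24) INSTANCE: the first step `k = 0`, the scalar factor at the background `B^{(1)}` regular on `T_ε` -/

section LevelZero

variable {P : HiggsLattice.Params} {N : ℕ} (C : ChargeData N)

open B1Eq324SmallFieldLeaf (siteVar_le_of_ineq233_lower')
open B1Ineq233LowerBackgroundTorus (ineq233_lower_regular_torus_levelZero)

/-- The (2.33)-type scalar diagonal bound AT LEVEL `0` FOR A REGULAR BACKGROUND on the whole torus: with r14's level-`0` lower half
`ineq233_lower_regular_torus_levelZero` (`(3c₁⁰/4)ε^{−2}‖ψ‖² ≤ ⟨ψ,(a(Lε)^{−2}P(A) + (−Δ^ε_A + m²))ψ⟩`, `c₁⁰ = min{a,4}/L²`, for `A` `δ`-regular on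
`T_ε` with `L²d·(2dLε|e|δ)² ≤ 1`, at least two level-`1` sites per direction, `0 < K`) and r14's `siteVar_le_of_ineq233_lower'`:
`siteVar y i ≤ (3c₁⁰/4)⁻¹·ε^{−(d−2)}` under `dμ_{C^{(0)}_{T_ε}(T_ε,A)}` — the `σ_φ²` input of the §2 core for the measure of (3.24).
[cite: Balaban1982Higgs1, Prop. 2.3 (2.33) p.611; (2.17) p.610; (3.24) p.616] -/
theorem siteVar_le_levelZero_regular {msq a : ℝ} (hmsq : 0 < msq) (ha : 0 < a) (hL : 1 < P.L) (hK : 0 < P.K)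
    (hN2 : ∀ μ, 2 ≤ P.sitesPerDir 1 μ) (A : HiggsLattice.VecField P 0) {δ : ℝ} (hδ : 0 ≤ δ)
    (hreg : ∀ (z : HiggsLattice.Site P 0) (μ' ν : Fin P.d), |A ⟨z.shift ν, μ'⟩ - A ⟨z, μ'⟩| ≤ δ)
    (hθ : (P.L : ℝ) ^ 2 * P.d * (2 * P.d * P.L * (P.mesh 0 * |C.e|) * δ) ^ 2 ≤ 1)
    (y : HiggsLattice.Site P 0) (i : Fin N) :
    siteVar P C Finset.univ A msq a 0 Finset.univ y i ≤ (3 * (min a 4 / (P.L : ℝ) ^ 2) / 4)⁻¹ * P.mesh 0 ^ (-((P.d : ℝ) - 2)) := by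
  have hLr : (1 : ℝ) < (P.L : ℝ) := by exact_mod_cast hL
  have hγ : 0 < 3 * (min a 4 / (P.L : ℝ) ^ 2) / 4 := by
    have : 0 < min a 4 := lt_min ha (by norm_num)
    positivity
  exact siteVar_le_of_ineq233_lower' C Finset.univ A hmsq ha hLr (Nat.zero_le _) Finset.univ hγ
    (fun f => ineq233_lower_regular_torus_levelZero C ha.le hmsq.le hK hN2 A hδ hreg hθ f) y i

/-- **THE (3.24) INSTANCE — `⟨χ exp(V)⟩ = exp[⟨V⟩ + (1/2!)⟨V²⟩^T + … + (1/n̄!)⟨V^{n̄}⟩^T + O(ε^κ)|T₁|]` FOR THE FIRST STEP `k = 0` WITH ITS OWN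
MEASURE `dμ_{C⁽⁰⁾}(A′)dμ_{C⁽⁰⁾(B⁽¹⁾)}(φ′)` (p. 616), THE BACKGROUND `B^{(1)}` REGULAR ON `T_ε`, MODULO LEAF (c) ONLY**: the §2 core
`eq359_displayed_of_leafC` at `k = 0`, `Ω = T_ε`, scalar background `A = B^{(1)}` `δ`-regular with `L²d·(2dLε|e|δ)² ≤ 1` (the first-step
regularity of row B1.Eq3.4–3.5 in r14's level-`0` (2.23) currency), the scalar diagonal bound fed by `siteVar_le_levelZero_regular`
(`σ_φ² = (3 min{a,4}/(4L²))⁻¹`): under `μ₀², m² > 0`, `a > 0`, `L > 1`, `0 < K`, `ε ≤ 1`, `N ≥ 1`, at least two level-`1` sites per direction,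
the (3.12)/(3.43)-type threshold `t = ε^{−(d−2)/2}p₁(ε)` (`b₁ > 0`), the smallness `e^{−p₁(ε)²/(2dσ_A²)}, e^{−p₁(ε)²/(2Nσ_φ²)} ≤ ε^{2K}`, tail totals
`2d|T_ε|ε^{2K}, 2N|T_ε|ε^{2K} ≤ ¼`, kernels obeying (3.58)-type decay and LEAF (c) `hc`:
`Eq324 (integral356C C T_ε B^{(1)} μ₀² m² a 0 t (V357 0 qmax coef)) (κ_·(⟨V^·⟩)) n̄ (4(d+N) + leafBConst n̄ M·√(2(d+N)) + C₃) ε K |T_ε|`,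
`M = polyMomentBound univ coefOf qmax n̄ (σ_A² ⊔ σ_φ²)` — r01/r12's typed (3.24) `B1Sect3Statements.Eq324` ON ITS OWN INSTANCE (row B1.Eq3.24,
owner r12; zero head weight while leaf (c) = the lemma of [2] p. 152 is external). [cite: Balaban1982Higgs1, (3.24) p.616; (3.22) p.615; Prop. 2.3 (2.33) p.611; (2.17) p.610] -/
theorem eq324_displayed_levelZero_regular_of_leafC {μ0sq msq a : ℝ} (hμ : 0 < μ0sq) (hmsq : 0 < msq) (ha : 0 < a) (hL : 1 < P.L)
    (hK : 0 < P.K) (hs : P.mesh 0 ≤ 1) (hN : 0 < N) (hN2 : ∀ μ, 2 ≤ P.sitesPerDir 1 μ)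
    (A : HiggsLattice.VecField P 0) {δ : ℝ} (hδ : 0 ≤ δ)
    (hreg : ∀ (z : HiggsLattice.Site P 0) (μ' ν : Fin P.d), |A ⟨z.shift ν, μ'⟩ - A ⟨z, μ'⟩| ≤ δ)
    (hθ : (P.L : ℝ) ^ 2 * P.d * (2 * P.d * P.L * (P.mesh 0 * |C.e|) * δ) ^ 2 ≤ 1)
    {b₁ p₁ : ℝ} (hb : 0 < b₁) {K : ℕ}
    (hexpA : Real.exp (-(B2.pFn b₁ p₁ (P.mesh 0) ^ 2
        / (2 * P.d * (min a (8 * gamma0 P a μ0sq) / (P.L : ℝ) ^ 2)⁻¹))) ≤ P.mesh 0 ^ (2 * K))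
    (hexpφ : Real.exp (-(B2.pFn b₁ p₁ (P.mesh 0) ^ 2
        / (2 * N * (3 * (min a 4 / (P.L : ℝ) ^ 2) / 4)⁻¹))) ≤ P.mesh 0 ^ (2 * K))
    (hsmallA : 2 * P.d * Fintype.card (HiggsLattice.Site P 0) * P.mesh 0 ^ (2 * K) ≤ 1 / 4)
    (hsmallφ : 2 * N * Fintype.card (HiggsLattice.Site P 0) * P.mesh 0 ^ (2 * K) ≤ 1 / 4)
    (qmax : ℕ) (coef : (q : ℕ) → (Fin q → HiggsLattice.Site P 0) → (Fin q → Leg N P.d) → ℝ)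
    {A₀ δ₀ : ℝ} (hA₀ : 0 ≤ A₀) (hδ₀ : 0 < δ₀)
    (h358 : ∀ q, q ≤ qmax → ∀ (z : Fin q → HiggsLattice.Site P 0) (κ : Fin q → Leg N P.d),
      |coef q z κ| ≤ A₀ * Real.exp (-(δ₀ * (diam z : ℝ))))
    (nbar : ℕ) {C₃ : ℝ}
    (hc : ∀ t ∈ Set.Icc (0 : ℝ) 1,
      |iteratedDeriv (nbar + 1) (cgf (rv357 0 qmax coef)
          (chiMeasure (law356 C Finset.univ A μ0sq msq a 0) (chi356 0 (thrF P.d (P.mesh 0) (B2.pFn b₁ p₁ (P.mesh 0)))))) t|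
        ≤ C₃ * ((nbar + 1)! : ℝ) * P.mesh 0 ^ K * Fintype.card (HiggsLattice.Site P 0)) :
    B1Sect3Statements.Eq324
      (B1Eq356FluctuationIntegral.integral356C C Finset.univ A μ0sq msq a 0
        (thrF P.d (P.mesh 0) (B2.pFn b₁ p₁ (P.mesh 0))) (V357 0 qmax coef))
      (cumulantOf (nmoment (rv357 0 qmax coef) (law356 C Finset.univ A μ0sq msq a 0))) nbar
      (4 * (P.d + N)
        + leafBConst nbar (polyMomentBound Finset.univ (coefOf 0 qmax coef) qmax nbar
            (max ((min a (8 * gamma0 P a μ0sq) / (P.L : ℝ) ^ 2)⁻¹) (3 * (min a 4 / (P.L : ℝ) ^ 2) / 4)⁻¹).toNNReal)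
          * Real.sqrt (2 * (P.d + N))
        + C₃)
      (P.mesh 0) K (Fintype.card (HiggsLattice.Site P 0)) := by
  have hγ : 0 < 3 * (min a 4 / (P.L : ℝ) ^ 2) / 4 := by
    have : 0 < min a 4 := lt_min ha (by norm_num)
    positivity
  exact eq359_displayed_of_leafC C Finset.univ A hμ hmsq ha hL hK hs hN (inv_pos.mpr hγ)
    (siteVar_le_levelZero_regular C hmsq ha hL hK hN2 A hδ hreg hθ) hb hexpA hexpφ hsmallA hsmallφ qmax coef hA₀ hδ₀ h358 nbar hc

end LevelZero

/-! ## §6 (v1.2) Levels `1 ≤ k < K` at the background `A^{(k),ε}` of (3.29) on the cube sub-family — the `k`-th step's own measure -/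

section Background

open B1Eq356FluctuationIntegral (integral356C)
open B1Eq324SmallFieldLeaf (siteVar_le_of_ineq233_lower')
open B1Eq31Concrete (bgVec)
open B1Eq211ZeroFieldTorus (Shape)
open B1Ineq233LowerBackgroundTorus (ineq233_lower_bgVec_torus)
open B3MultiscaleFields (toSite)

/-- **THE SCALAR DIAGONAL BOUND AT THE BACKGROUND `A^{(k),ε}` OF (3.29)** (`B1Eq31Concrete.bgVec μ₀² a k A`, `A` a block field on `T^{(k)}`):
for `d ≥ 1`, odd `L > 1`, `a, μ₀², m² > 0`, `N`, `(e, q)` there are `σ₁² > 0` and `c_A > 0` (functions of these data only) such that on every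
torus of the sub-family `M·L′_μ = L^m` with these `d, L`, at every level `1 ≤ k < K` with at least two `(k+1)`-sites per direction and `L^kε ≤ 1`,
for every `A` with `|A(x)| ≤ r`, `r·L^kε ≤ c_A`, EVERY conditioning set `Λ`, site and component: `siteVar y i ≤ σ₁²·(L^kε)^{−(d−2)}` under
`dμ_{C^{(k)}_Λ(T_ε, A^{(k),ε})}` — r14 g13's (2.33)ₗ at the (3.29) background `B1Ineq233LowerBackgroundTorus.ineq233_lower_bgVec_torus` fed into r14's
`siteVar_le_of_ineq233_lower'` (`σ₁² = γ⁻¹`). [cite: Balaban1982Higgs1, Prop. 2.3 (2.33) p.611; (3.29) p.617] -/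
theorem siteVar_le_bgVec_torus (d L : ℕ) (hd : 1 ≤ d) (hL : Odd L ∧ 1 < L) {a μ0sq msq : ℝ} (ha : 0 < a) (hμ : 0 < μ0sq)
    (hmsq : 0 < msq) (N : ℕ) (C : ChargeData N) :
    ∃ σ1sq cA : ℝ, 0 < σ1sq ∧ 0 < cA ∧
      ∀ (P : HiggsLattice.Params) (_S : Shape P), P.d = d → P.L = L →
      ∀ {k : ℕ}, 1 ≤ k → k < P.K → (∀ μ, 2 ≤ P.sitesPerDir (k + 1) μ) → P.mesh k ≤ 1 →
      ∀ {r : ℝ}, r * P.mesh k ≤ cA →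
      ∀ A : HiggsLattice.VecField P k, (∀ x, ‖toSite A x‖ ≤ r) →
        ∀ (Λ : Finset (HiggsLattice.Site P k)) (y : HiggsLattice.Site P k) (i : Fin N),
          siteVar P C Finset.univ (bgVec (P := P) μ0sq a k A) msq a k Λ y i ≤ σ1sq * P.mesh k ^ (-((P.d : ℝ) - 2)) := by
  obtain ⟨γ, hγ, cA, hcA, h⟩ := ineq233_lower_bgVec_torus d L hd hL ha hμ hmsq N C
  refine ⟨γ⁻¹, cA, inv_pos.mpr hγ, hcA, fun P S hPd hPL k hk1 hk hN2 hs r hr A hA Λ y i => ?_⟩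
  have hLr : (1 : ℝ) < (P.L : ℝ) := by rw [hPL]; exact_mod_cast hL.2
  exact siteVar_le_of_ineq233_lower' C Finset.univ (bgVec (P := P) μ0sq a k A) hmsq ha hLr hk.le Λ hγ
    (fun f => h P S hPd hPL hk1 hk hN2 hs hr A hA f) y i

/-- **(3.59) IN THE PRINTED SHAPE FOR THE `k`-TH STEP'S OWN MEASURE `dμ_{C^{(k)}}(A′)dμ_{C^{(k)}(A^{(k),ε})}(φ′)` — THE BACKGROUND `A^{(k),ε}` OF
(3.29) — ON THE CUBE SUB-FAMILY, MODULO LEAF (c) ONLY**: for `d ≥ 1`, odd `L > 1`, `a, μ₀², m² > 0`, `N ≥ 1`, `(e, q)` there are `σ₁² > 0`, `c_A > 0`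
such that on every torus of the sub-family with these `d, L`, at every level `1 ≤ k < K` (two `(k+1)`-sites per direction, `L^kε ≤ 1`), for every
block field `A` on `T^{(k)}` with `|A(x)| ≤ r`, `r·L^kε ≤ c_A`, the §2 core `eq359_displayed_of_leafC` holds at `Ω = T_ε`, `B = A^{(k),ε}` with
`σ_φ² = σ₁²`: under the (3.43)/(3.50) threshold `t = (L^kε)^{−(d−2)/2}p₁(L^kε)` (`b₁ > 0`), the scale-free smallness and tail totals at the exponent
`2K`, kernels obeying (3.58) (diameter currency) and LEAF (c) `hc`,
`Eq324 (integral356C C T_ε A^{(k),ε} μ₀² m² a k t (V357 k qmax coef)) (κ_·(⟨(V^{(k)})^·⟩)) n̄ (4(d+N) + leafBConst n̄ M·√(2(d+N)) + C₃) (L^kε) K |T^{(k)}|`,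
`M = polyMomentBound univ coefOf qmax n̄ (σ_A² ⊔ σ₁²)` — the scalar diagonal bound by `siteVar_le_bgVec_torus`.  Per lattice; zero head weight.
[cite: Balaban1982Higgs1, (3.59) p.623; (3.24) p.616; (3.56)–(3.58) p.622; (3.29) p.617; Prop. 2.3 (2.33) p.611] -/
theorem eq359_displayed_bgVec_of_leafC (d L : ℕ) (hd : 1 ≤ d) (hL : Odd L ∧ 1 < L) {a μ0sq msq : ℝ} (ha : 0 < a) (hμ : 0 < μ0sq)
    (hmsq : 0 < msq) (N : ℕ) (hN : 0 < N) (C : ChargeData N) :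
    ∃ σ1sq cA : ℝ, 0 < σ1sq ∧ 0 < cA ∧
      ∀ (P : HiggsLattice.Params) (_S : Shape P), P.d = d → P.L = L →
      ∀ {k : ℕ}, 1 ≤ k → k < P.K → (∀ μ, 2 ≤ P.sitesPerDir (k + 1) μ) → P.mesh k ≤ 1 →
      ∀ {r : ℝ}, r * P.mesh k ≤ cA →
      ∀ A : HiggsLattice.VecField P k, (∀ x, ‖toSite A x‖ ≤ r) →
      ∀ {b₁ p₁ : ℝ}, 0 < b₁ → ∀ {K : ℕ},
        Real.exp (-(B2.pFn b₁ p₁ (P.mesh k) ^ 2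
            / (2 * P.d * (min a (8 * gamma0 P a μ0sq) / (P.L : ℝ) ^ 2)⁻¹))) ≤ P.mesh k ^ (2 * K) →
        Real.exp (-(B2.pFn b₁ p₁ (P.mesh k) ^ 2 / (2 * N * σ1sq))) ≤ P.mesh k ^ (2 * K) →
        2 * P.d * Fintype.card (HiggsLattice.Site P k) * P.mesh k ^ (2 * K) ≤ 1 / 4 →
        2 * N * Fintype.card (HiggsLattice.Site P k) * P.mesh k ^ (2 * K) ≤ 1 / 4 →
      ∀ (qmax : ℕ) (coef : (q : ℕ) → (Fin q → HiggsLattice.Site P k) → (Fin q → Leg N P.d) → ℝ) {A₀ δ₀ : ℝ},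
        0 ≤ A₀ → 0 < δ₀ →
        (∀ q, q ≤ qmax → ∀ (z : Fin q → HiggsLattice.Site P k) (κ : Fin q → Leg N P.d),
            |coef q z κ| ≤ A₀ * Real.exp (-(δ₀ * (diam z : ℝ)))) →
      ∀ (nbar : ℕ) {C₃ : ℝ},
        (∀ t ∈ Set.Icc (0 : ℝ) 1,
          |iteratedDeriv (nbar + 1) (cgf (rv357 k qmax coef)
              (chiMeasure (law356 C Finset.univ (bgVec (P := P) μ0sq a k A) μ0sq msq a k)
                (chi356 k (thrF P.d (P.mesh k) (B2.pFn b₁ p₁ (P.mesh k)))))) t|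
            ≤ C₃ * ((nbar + 1)! : ℝ) * P.mesh k ^ K * Fintype.card (HiggsLattice.Site P k)) →
        B1Sect3Statements.Eq324
          (integral356C C Finset.univ (bgVec (P := P) μ0sq a k A) μ0sq msq a k
            (thrF P.d (P.mesh k) (B2.pFn b₁ p₁ (P.mesh k))) (V357 k qmax coef))
          (cumulantOf (nmoment (rv357 k qmax coef) (law356 C Finset.univ (bgVec (P := P) μ0sq a k A) μ0sq msq a k))) nbar
          (4 * (P.d + N)
            + leafBConst nbar (polyMomentBound Finset.univ (coefOf k qmax coef) qmax nbar
                (max ((min a (8 * gamma0 P a μ0sq) / (P.L : ℝ) ^ 2)⁻¹) σ1sq).toNNReal)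
              * Real.sqrt (2 * (P.d + N))
            + C₃)
          (P.mesh k) K (Fintype.card (HiggsLattice.Site P k)) := by
  obtain ⟨σ1sq, cA, hσ, hcA, hdiag⟩ := siteVar_le_bgVec_torus d L hd hL ha hμ hmsq N C
  refine ⟨σ1sq, cA, hσ, hcA, fun P S hPd hPL k hk1 hk hN2 hs r hr A hA b₁ p₁ hb K hexpA hexpφ hsmallA hsmallφ qmax coef A₀ δ₀ hA₀ hδ₀ h358
    nbar C₃ hc => ?_⟩
  have hL1 : 1 < P.L := by rw [hPL]; exact hL.2
  exact eq359_displayed_of_leafC C Finset.univ (bgVec (P := P) μ0sq a k A) hμ hmsq ha hL1 hk hs hN hσ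
    (fun y i => hdiag P S hPd hPL hk1 hk hN2 hs hr A hA Finset.univ y i) hb hexpA hexpφ hsmallA hsmallφ qmax coef hA₀ hδ₀ h358 nbar hc

end Background


end

end Literature.MathematicalPhysics.QuantumFieldTheory.Balaban1983to89.B1Eq324DisplayedInteractionLeafModels
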